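import Literature.NumberTheory.LFunctions.RodgersTaoAsymptotics
import Literature.Analysis.SpecialFunctions.GammaStirlingRightHalfPlane
import Literature.Analysis.Complex.HorizontalStripResidues
import Mathlib.Analysis.SpecialFunctions.Gaussian.FourierTransform
import Mathlib.MeasureTheory.Function.JacobianOneDim
import HarnessLib

/-!
# Rodgers–Tao 2020, Lemma 2.4 (= FMP Lemma 7): `I_t(b, 4b) = √(π/8) e^{−b}(b^{−1/2} + O(|b|^{−3/2}))` — the proof

RH-FREE LITERATURE (label line, cell rh-crit C3, seat rt-t6 on the lead's open list Q2): companion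
PROOFS file of `RodgersTaoAsymptotics.lean` (seat rt-t1), discharging the named fact
`Literature.NumberTheory.LFunctions.rodgersTao_I_stationary` — B. Rodgers, T. Tao, *The de Bruijn–Newman
constant is non-negative*, Forum Math. Pi 8 (2020) e6, **Lemma 7** p. 15 (= arXiv:1801.05914v4
Lemma 2.4), eq. (30): for `Re b ≥ 1` (and `t < 0`, `|t| = O(1)`),
`I_t(b, 4b) = √(π/8) exp(−b) (1/√b + O(1/|b|^{3/2}))`, where
`I_t(b, ζ) = ∫_ℝ exp(tw² − b e^{4w} + ζw) dw` (eq. (19), `rodgersTaoI`). Nothing here bears on the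
truth of RH: this is a Laplace/Stirling asymptotic for a Gaussian-type integral.

## The printed proof (FMP pp. 15–16 = arXiv v5 TeX l.394–423, "reproduced" there from A. Dobner's
repair) and this formalisation

1. "Writing `e^{tw²} = ∫_ℝ e^{4iξw} dμ(ξ)` where `μ` is the Gaussian probability measure
   `dμ(ξ) = (2/√(π|t|)) e^{−4ξ²/|t|} dξ`" — `RodgersTaoStationary.rho`, `integral_rho`,
   `gaussian_rep` (Mathlib's `integral_cexp_quadratic`).
2. "applying Fubini's theorem" — `rodgersTaoI_eq_integral_Gfun` (`integral_integral_swap`, the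
   joint integrand being dominated by `ρ(ξ) · |exp(−b e^{4w} + 4bw)|`).
3. "Making the change of variables `r = b e^{4w}` (and contour shifting or analytic continuation) and
   the definition `Γ(s) = ∫₀^∞ e^{−r} r^{s−1} dr` … `∫_ℝ exp(−b e^{4w} + 4(b+iξ)w) dw =
   ¼ exp(−(b+iξ) log b) Γ(b+iξ)`" — `Gfun_ofReal` (real `b`: the change of variables `r = e^{4w}`,
   `MeasureTheory.integral_image_eq_integral_abs_deriv_smul`, and Mathlib's
   `Complex.integral_cpow_mul_exp_neg_mul_Ioi`) and `Gfun_eq` (complex `b`, `Re b > 0`: the contour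
   shift `Im w = 0 → Im w = (arg b)/4` via
   `Literature.Analysis.Complex.integral_horizontal_eq_of_differentiableOn`, with an explicit
   cross-section decay estimate); hence `rodgersTaoI_eq_integral_Gamma`:
   `I_t(b,4b) = ∫ ρ(ξ) ¼ Γ(b+iξ) b^{−(b+iξ)} dξ`.
4. "By applying Stirling's approximation … `(b+iξ) log(1 + iξ/b) = iξ + O(|ξ|²/|b|)` …" —
   `main_expansion`: for `|ξ| ≤ |b|/2`, `Γ(b+iξ) b^{−(b+iξ)} = √(2π) e^{−b} b^{−1/2} e^{R}` with
   `|R| ≤ 3(ξ² + 1)/|b|` (Stirling with phase on `Re s ≥ 1`: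
   `Literature.Analysis.SpecialFunctions.GammaStirling.exists_Gamma_eq_exp_stirling_of_one_le_re`,
   error `≤ 1/|s|`; `Log(b(1+u)) = Log b + Log(1+u)`; Mathlib's bounds for `Log(1+u) − u`).
5. The tail "`|exp(−(b+iξ)log b)| ≤ exp(−Re b log|b| + (π/2)(|b| + |ξ|))` and
   `|Γ(b+iξ)| ≤ Γ(Re b) ≤ exp(Re b log|b| − Re b)`" — `crude_bound`
   (`‖Γ(b+iξ) b^{−(b+iξ)}‖ ≤ 4 e^{−Re b} e^{(π/2)(|b|+|ξ|)}` for all `ξ`; the real Stirling upper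
   bound `real_Gamma_le` is from the tree's `GammaStirling.abs_log_norm_Gamma_sub_le`).
6. Assembly — `large_b_bound`: for `|b| ≥ max(4|t|, 4)` the regions `ξ² ≤ |t||b|` (main) and
   `ξ² > |t||b|` (tail) are bounded pointwise by two explicit Gaussian-type functions `hOne`, `hTwo`
   whose integrals are evaluated (`integral_gaussian`), giving
   `‖I_t(b,4b) − √(π/8)e^{−b}b^{−1/2}‖ ≤ (2e^{3|t|+1}(1+|t|) + 10) e^{−Re b}/|b|^{3/2}`.
   (The source splits at `|ξ| = 10|t|^{1/2}|b|^{1/2}`; we split at `|t|^{1/2}|b|^{1/2}`, which keeps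
   `|R| = O_{|t|}(1)` on the main region; the constants are not the source's, which prints none.)
7. "the small `|b|` case of the lemma follows trivially from compactness" — replaced by the
   explicit crude bound `‖I_t(b, 4b)‖ ≤ e^{−Re b}` (`norm_rodgersTaoI_le`: the integrand is dominated
   by `exp(−σe^{4w} + 4σw)`, `σ = Re b`, whose integral is `¼Γ(σ)σ^{−σ} ≤ σ^{−1/2}e^{−σ}`), valid for
   all `b`, so no compactness/continuity argument is needed.

Typed range of the fact (seat rt-t1): `−T₀ ≤ t < 0`, constant `A = A(T₀)`; here
`A = 2e^{3T₁+1}(1+T₁) + 10 + 2(4T₁+4)^{3/2}`, `T₁ = max(T₀, 1)`.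

## Main results (namespace `Literature.NumberTheory.LFunctions`)

* `RodgersTaoStationary.Gfun_eq` — the `Γ`-identity `∫_ℝ exp(−b e^{4w} + 4sw) dw = ¼ Γ(s) b^{−s}`
  (`Re b > 0`, `Re s > 0`);
* `RodgersTaoStationary.rodgersTaoI_eq_integral_Gamma` — `I_t(b,4b) = ∫ ρ(ξ)·¼Γ(b+iξ)b^{−(b+iξ)} dξ`;
* `RodgersTaoStationary.main_expansion`, `RodgersTaoStationary.crude_bound`,
  `RodgersTaoStationary.large_b_bound`, `RodgersTaoStationary.norm_rodgersTaoI_le`;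
* **`rodgersTao_I_stationary_holds`** — the discharge (CONTENT).

Proof-internal plumbing definitions (not mathematical notions): `gInt`, `Gfun`, `hInt`, `gC`, `rho`,
`Phi`, `rhoK`, `mainTerm`, `hOne`, `hTwo` (all in `RodgersTaoStationary`).

## References

* B. Rodgers, T. Tao, *The de Bruijn–Newman constant is non-negative*, Forum Math. Pi 8 (2020) e6
  (arXiv:1801.05914v5), §2, Lemma 7 (= arXiv Lemma 2.4), eq. (19), (30), and its proof pp. 15–16.
  [RodgersTaoFMP2020]
* E. T. Whittaker, G. N. Watson, *A Course of Modern Analysis*, 4th ed. (1927), §12.2 (Euler's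
  integral), §12.33 (Stirling). [WhittakerWatson1927]
-/

noncomputable section

open Complex Filter Topology Set MeasureTheory
open scoped Real

namespace Literature.NumberTheory.LFunctions

namespace RodgersTaoStationary

open Literature.Analysis.SpecialFunctions.GammaStirling (exists_Gamma_eq_exp_stirling_of_one_le_re
  abs_log_norm_Gamma_sub_le)

/-! ## 1. The integrand of `G(b, s) = ∫ exp(−b e^{4w} + 4sw) dw` and the `Γ`-identity for real `b` -/

/-- The integrand `w ↦ exp(−b e^{4w} + 4 s w)`. [folklore] -/
def gInt (b s : ℂ) (w : ℝ) : ℂ := cexp (-b * cexp (4 * (w : ℂ)) + 4 * s * w)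

/-- `G(b, s) := ∫_ℝ exp(−b e^{4w} + 4 s w) dw`.
[cite: RodgersTaoFMP2020, Lemma 2.4 proof (FMP Lemma 7 p. 15)] -/
def Gfun (b s : ℂ) : ℂ := ∫ w : ℝ, gInt b s w

/-- Helper (norm gInt). [folklore] -/
private theorem norm_gInt (b s : ℂ) (w : ℝ) :
    ‖gInt b s w‖ = Real.exp (-b.re * Real.exp (4 * w) + 4 * s.re * w) := by
  rw [gInt, Complex.norm_exp]
  congr 1
  have h4 : cexp (4 * (w : ℂ)) = ((Real.exp (4 * w) : ℝ) : ℂ) := by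
    rw [Complex.ofReal_exp]; push_cast; ring_nf
  rw [h4]
  simp only [Complex.add_re, neg_mul, Complex.neg_re, Complex.mul_re, Complex.ofReal_re,
    Complex.ofReal_im, Complex.re_ofNat, Complex.im_ofNat, mul_zero, sub_zero, zero_mul]

/-- Helper (continuous gInt). [folklore] -/
private theorem continuous_gInt (b s : ℂ) : Continuous (gInt b s) := by
  unfold gInt; fun_prop

/-- The Mellin-side integrand `h(r) = ¼ e^{−br} r^{s−1}` on `(0, ∞)`. [folklore] -/
def hInt (b s : ℂ) (r : ℝ) : ℂ := 1 / 4 * cexp (-b * r) * (r : ℂ) ^ (s - 1)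

/-- Change of variables `r = e^{4w}`: `|4 e^{4w}| • h(e^{4w}) = exp(−b e^{4w} + 4sw)`. [folklore] -/
private theorem jac_smul_hInt (b s : ℂ) (w : ℝ) :
    |4 * Real.exp (4 * w)| • hInt b s (Real.exp (4 * w)) = gInt b s w := by
  have hpos : 0 < Real.exp (4 * w) := Real.exp_pos _
  rw [abs_of_pos (by positivity), hInt, gInt, real_smul]
  have hlog : Complex.log ((Real.exp (4 * w) : ℝ) : ℂ) = 4 * (w : ℂ) := by
    rw [(Complex.ofReal_log hpos.le).symm, Real.log_exp]; push_cast; ring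
  have hcpow : ((Real.exp (4 * w) : ℝ) : ℂ) ^ (s - 1) = cexp ((s - 1) * (4 * (w : ℂ))) := by
    rw [Complex.cpow_def_of_ne_zero (by exact_mod_cast hpos.ne'), hlog, mul_comm]
  rw [hcpow]
  have h4 : ((Real.exp (4 * w) : ℝ) : ℂ) = cexp (4 * (w : ℂ)) := by
    rw [Complex.ofReal_exp]; push_cast; ring_nf
  push_cast
  rw [show (4 : ℂ) * cexp (4 * (w : ℂ)) * (1 / 4 * cexp (-b * cexp (4 * ↑w)) *
      cexp ((s - 1) * (4 * ↑w))) = cexp (4 * (w : ℂ)) * cexp (-b * cexp (4 * ↑w)) *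
      cexp ((s - 1) * (4 * ↑w)) by ring]
  rw [← Complex.exp_add, ← Complex.exp_add]
  congr 1
  ring

/-- The range of `w ↦ e^{4w}` is `(0, ∞)`. [folklore] -/
private theorem image_exp_four : (fun w : ℝ ↦ Real.exp (4 * w)) '' univ = Ioi 0 := by
  rw [image_univ]
  ext r
  constructor
  · rintro ⟨w, rfl⟩; exact Real.exp_pos _
  · intro hr
    refine ⟨Real.log r / 4, ?_⟩
    show Real.exp (4 * (Real.log r / 4)) = r
    rw [show 4 * (Real.log r / 4) = Real.log r by ring, Real.exp_log hr]

/-- Helper (injOn exp four). [folklore] -/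
private theorem injOn_exp_four : InjOn (fun w : ℝ ↦ Real.exp (4 * w)) univ := by
  intro x _ y _ h
  have := Real.exp_injective h
  linarith

/-- Helper (hasDerivWithinAt exp four). [folklore] -/
private theorem hasDerivWithinAt_exp_four (w : ℝ) :
    HasDerivWithinAt (fun w : ℝ ↦ Real.exp (4 * w)) (4 * Real.exp (4 * w)) univ w := by
  have h := ((hasDerivAt_id w).const_mul 4).exp
  simp only [mul_one, id] at h
  have : HasDerivAt (fun w : ℝ ↦ Real.exp (4 * w)) (4 * Real.exp (4 * w)) w := by
    convert h using 1; ring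
  exact this.hasDerivWithinAt

/-- `h` is integrable on `(0, ∞)` for `Re b > 0`, `Re s > 0`. [folklore] -/
private theorem integrableOn_hInt {b s : ℂ} (hb : 0 < b.re) (hs : 0 < s.re) :
    IntegrableOn (hInt b s) (Ioi 0) := by
  -- the norm is `¼ e^{−Re b · r} r^{Re s − 1}`, a scaled real Gamma integrand
  have hreal : IntegrableOn (fun r : ℝ ↦ Real.exp (-(b.re * r)) * r ^ (s.re - 1)) (Ioi 0) := by
    have h0 := Real.GammaIntegral_convergent hs
    have h1 := (integrableOn_Ioi_comp_mul_left_iff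
      (fun x : ℝ ↦ Real.exp (-x) * x ^ (s.re - 1)) 0 hb).2 (by simpa using h0)
    -- `exp(-(b.re x)) (b.re x)^(σ-1) = b.re^(σ-1) · (exp(-(b.re x)) x^(σ-1))`
    have h2 : IntegrableOn (fun x : ℝ ↦ (b.re ^ (s.re - 1))⁻¹ *
        (Real.exp (-(b.re * x)) * (b.re * x) ^ (s.re - 1))) (Ioi 0) := h1.const_mul _
    refine h2.congr_fun (fun x hx ↦ ?_) measurableSet_Ioi
    rw [mem_Ioi] at hx
    show (b.re ^ (s.re - 1))⁻¹ * (Real.exp (-(b.re * x)) * (b.re * x) ^ (s.re - 1)) =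
      Real.exp (-(b.re * x)) * x ^ (s.re - 1)
    rw [Real.mul_rpow hb.le hx.le]
    have : b.re ^ (s.re - 1) ≠ 0 := (Real.rpow_pos_of_pos hb _).ne'
    field_simp
  have hmeas : AEStronglyMeasurable (hInt b s) (volume.restrict (Ioi 0)) := by
    refine (ContinuousOn.mul (by fun_prop) ?_).aestronglyMeasurable measurableSet_Ioi
    exact ContinuousOn.cpow_const (by fun_prop) fun r hr ↦
      Or.inl (by simpa using (hr : 0 < r))
  refine Integrable.mono' (hreal.const_mul (1 / 4)) hmeas ?_
  refine (ae_restrict_iff' measurableSet_Ioi).2 (Filter.Eventually.of_forall fun r hr ↦ ?_)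
  rw [mem_Ioi] at hr
  rw [hInt, norm_mul, norm_mul, Complex.norm_exp, Complex.norm_cpow_eq_rpow_re_of_pos hr]
  simp [Complex.mul_re]
  ring_nf
  rfl

/-- The `w`-integrand is integrable (`Re b > 0`, `Re s > 0`).
[cite: RodgersTaoFMP2020, §2 eq. (19) (FMP p. 11)] -/
theorem integrable_gInt {b s : ℂ} (hb : 0 < b.re) (hs : 0 < s.re) : Integrable (gInt b s) := by
  have h := (integrableOn_image_iff_integrableOn_abs_deriv_smul MeasurableSet.univ
    (fun w _ ↦ hasDerivWithinAt_exp_four w) injOn_exp_four (hInt b s)).1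
    (by rw [image_exp_four]; exact integrableOn_hInt hb hs)
  rw [integrableOn_univ] at h
  exact h.congr (Filter.Eventually.of_forall fun w ↦ jac_smul_hInt b s w)

/-- **The `Γ`-identity for real `b = B > 0`**: `∫_ℝ exp(−B e^{4w} + 4 s w) dw = ¼ Γ(s) B^{−s}`
(`Re s > 0`). Change of variables `r = B e^{4w}` in Euler's integral.
[cite: WhittakerWatson1927, §12.2] [cite: RodgersTaoFMP2020, Lemma 2.4 proof (FMP Lemma 7 p. 15)] -/
theorem Gfun_ofReal {B : ℝ} (hB : 0 < B) {s : ℂ} (hs : 0 < s.re) :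
    Gfun (B : ℂ) s = 1 / 4 * Complex.Gamma s * (B : ℂ) ^ (-s) := by
  have hcov := integral_image_eq_integral_abs_deriv_smul MeasurableSet.univ
    (fun w _ ↦ hasDerivWithinAt_exp_four w) injOn_exp_four (hInt (B : ℂ) s)
  rw [image_exp_four, Measure.restrict_univ] at hcov
  simp_rw [jac_smul_hInt] at hcov
  rw [Gfun, ← hcov]
  -- `∫₀^∞ ¼ e^{-Br} r^{s-1} dr = ¼ Γ(s) B^{-s}`
  have hm := Complex.integral_cpow_mul_exp_neg_mul_Ioi hs hB
  have : (fun r : ℝ ↦ hInt (B : ℂ) s r) = fun r : ℝ ↦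
      (1 / 4 : ℂ) * ((r : ℂ) ^ (s - 1) * cexp (-(B * r))) := by
    funext r; rw [hInt]; ring_nf
  rw [this, integral_const_mul, hm]
  have hB0 : (B : ℂ) ≠ 0 := by exact_mod_cast hB.ne'
  rw [one_div (B : ℂ), Complex.inv_cpow _ _ ?_, Complex.cpow_neg]
  · ring
  · -- `arg B ≠ π`
    rw [Complex.arg_ofReal_of_nonneg hB.le]; exact Real.pi_ne_zero.symm

/-! ## 2. Complex `b`: the contour shift `Im w = 0 → Im w = (arg b)/4` -/

/-- The complex-variable integrand `w ↦ exp(−B e^{4w} + 4 s w)` (`w ∈ ℂ`). [folklore] -/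
def gC (B s : ℂ) (w : ℂ) : ℂ := cexp (-B * cexp (4 * w) + 4 * s * w)

/-- Helper (differentiable gC). [folklore] -/
private theorem differentiable_gC (B s : ℂ) : Differentiable ℂ (gC B s) := by
  unfold gC; fun_prop

/-- Helper (gC ofReal). [folklore] -/
private theorem gC_ofReal (B s : ℂ) (x : ℝ) : gC B s ((x : ℂ) + (0 : ℝ) * I) = gInt B s x := by
  simp [gC, gInt]

/-- On the line `Im w = θ/4`, `θ = arg b`: `gC(|b|, s)(x + iθ/4) = e^{isθ} · exp(−b e^{4x} + 4sx)`.
[folklore] -/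
private theorem gC_shift (b s : ℂ) (x : ℝ) :
    gC (‖b‖ : ℂ) s ((x : ℂ) + ((Complex.arg b / 4 : ℝ) : ℂ) * I) =
      cexp (I * s * Complex.arg b) * gInt b s x := by
  have hb : (‖b‖ : ℂ) * cexp ((Complex.arg b : ℂ) * I) = b := by
    exact_mod_cast Complex.norm_mul_exp_arg_mul_I b
  rw [gC, gInt, ← Complex.exp_add]
  have h4 : (4 : ℂ) * ((x : ℂ) + ((Complex.arg b / 4 : ℝ) : ℂ) * I) =
      4 * (x : ℂ) + (Complex.arg b : ℂ) * I := by push_cast; ring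
  rw [h4, show cexp (4 * (x : ℂ) + (Complex.arg b : ℂ) * I) =
    cexp (4 * (x : ℂ)) * cexp ((Complex.arg b : ℂ) * I) from Complex.exp_add _ _]
  congr 1
  rw [show -(‖b‖ : ℂ) * (cexp (4 * (x : ℂ)) * cexp ((Complex.arg b : ℂ) * I)) =
    -((‖b‖ : ℂ) * cexp ((Complex.arg b : ℂ) * I)) * cexp (4 * (x : ℂ)) by ring, hb]
  push_cast
  ring

/-- Norm of `gC(B, s)` at `T + iy` for real `B ≥ 0`:
`exp(−B e^{4T} cos(4y) + 4(Re s · T − Im s · y))`. [folklore] -/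
private theorem norm_gC_ofReal (B : ℝ) (s : ℂ) (T y : ℝ) :
    ‖gC (B : ℂ) s ((T : ℂ) + (y : ℂ) * I)‖ =
      Real.exp (-B * Real.exp (4 * T) * Real.cos (4 * y) + 4 * (s.re * T - s.im * y)) := by
  rw [gC, Complex.norm_exp]
  congr 1
  have h4 : (4 : ℂ) * ((T : ℂ) + (y : ℂ) * I) = ((4 * T : ℝ) : ℂ) + ((4 * y : ℝ) : ℂ) * I := by
    push_cast; ring
  rw [h4, Complex.exp_add_mul_I, ← Complex.ofReal_exp, ← Complex.ofReal_cos, ← Complex.ofReal_sin]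
  simp only [Complex.add_re, neg_mul, Complex.neg_re, Complex.mul_re, Complex.ofReal_re,
    Complex.ofReal_im, Complex.re_ofNat, Complex.im_ofNat, Complex.I_re, Complex.I_im,
    mul_zero, sub_zero, zero_mul, mul_one, add_zero, Complex.mul_im, Complex.add_im, zero_add]
  ring

/-- Uniform smallness of `gC(B, s)` on the cross-sections `Re w = ±T`, `|y| ≤ Y < π/8`, for
`B > 0`, `Re s > 0`: given `ε > 0` there is `T₀` with `‖gC(B,s)(T + iy)‖ ≤ ε` for `|T| ≥ T₀`.
[folklore] -/
private theorem gC_decay {B : ℝ} (hB : 0 < B) {s : ℂ} (hs : 0 < s.re) {Y : ℝ} (hY0 : 0 ≤ Y)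
    (hY : Y < π / 8) {ε : ℝ} (hε : 0 < ε) :
    ∃ T₀ : ℝ, ∀ T : ℝ, T₀ ≤ |T| → ∀ y : ℝ, |y| ≤ Y →
      ‖gC (B : ℂ) s ((T : ℂ) + (y : ℂ) * I)‖ ≤ ε := by
  -- `cos(4y) ≥ 0` on `|y| ≤ Y`, so the norm is at most `exp(4 Re s · T + 4 |Im s| Y)` for `T ≤ 0`
  -- and at most `exp(-B cos(4Y) e^{4T} + 4 Re s · T + 4 |Im s| Y)` for `T ≥ 0`.
  set C₀ : ℝ := 4 * |s.im| * Y with hC₀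
  set c : ℝ := B * Real.cos (4 * Y) with hc
  have hcos : 0 < Real.cos (4 * Y) := Real.cos_pos_of_mem_Ioo ⟨by linarith, by linarith⟩
  have hc0 : 0 < c := mul_pos hB hcos
  -- choose `T₀`
  obtain ⟨T₁, hT₁⟩ : ∃ T₁ : ℝ, 0 < T₁ ∧ ∀ T : ℝ, T₁ ≤ T →
      -c * Real.exp (4 * T) + 4 * s.re * T ≤ -T := by
    -- `e^{4T} ≥ 8T²` for `T ≥ 0`, so it suffices that `8cT² ≥ (4 Re s + 1) T`, i.e. `T ≥ (4 Re s + 1)/(8c)`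
    refine ⟨(4 * s.re + 1) / (8 * c) + 1, by positivity, fun T hT ↦ ?_⟩
    have hT0 : 0 ≤ T := by
      have : 0 < (4 * s.re + 1) / (8 * c) := by positivity
      linarith
    have hexp : 8 * T ^ 2 ≤ Real.exp (4 * T) := by
      have h1 : 1 + 4 * T + (4 * T) ^ 2 / 2 ≤ Real.exp (4 * T) := by
        have := Real.quadratic_le_exp_of_nonneg (show 0 ≤ 4 * T by linarith)
        linarith
      nlinarith
    have hcT : (4 * s.re + 1) * T ≤ 8 * c * T ^ 2 := by
      have h1 : (4 * s.re + 1) / (8 * c) ≤ T := by linarith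
      have h2 : 4 * s.re + 1 ≤ 8 * c * T := by
        rw [div_le_iff₀ (by positivity)] at h1; linarith
      nlinarith
    nlinarith [mul_le_mul_of_nonneg_left hexp hc0.le]
  obtain ⟨hT₁0, hT₁⟩ := hT₁
  set κ : ℝ := min 1 (4 * s.re) with hκ
  have hκ0 : 0 < κ := lt_min one_pos (by linarith)
  -- `exp(-κ T₀ + C₀) ≤ ε` for `T₀ ≥ (C₀ - log ε)/κ`
  set T₀ : ℝ := max T₁ ((C₀ - Real.log ε) / κ) with hT₀
  refine ⟨T₀, fun T hT y hy ↦ ?_⟩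
  have hyY : |4 * y| ≤ 4 * Y := by rw [abs_mul, abs_of_pos (by norm_num : (0:ℝ) < 4)]; linarith
  have hcos_y : Real.cos (4 * Y) ≤ Real.cos (4 * y) := by
    rw [← Real.cos_abs (4 * y)]
    exact Real.cos_le_cos_of_nonneg_of_le_pi (abs_nonneg _) (by linarith) hyY
  have hcos_y0 : 0 ≤ Real.cos (4 * y) := hcos.le.trans hcos_y
  rw [norm_gC_ofReal]
  -- the exponent is at most `-κ |T| + C₀`
  have hexpo : -B * Real.exp (4 * T) * Real.cos (4 * y) + 4 * (s.re * T - s.im * y) ≤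
      -κ * |T| + C₀ := by
    have hsy : -(s.im * y) ≤ |s.im| * Y := by
      have := abs_mul s.im y
      have h2 : |s.im * y| ≤ |s.im| * Y := by rw [abs_mul]; exact mul_le_mul_of_nonneg_left hy (abs_nonneg _)
      linarith [neg_abs_le (s.im * y)]
    rcases le_or_gt 0 T with hT0 | hT0
    · -- `T ≥ 0`: here `|T| = T ≥ T₁`
      rw [abs_of_nonneg hT0] at hT ⊢
      have hTT₁ : T₁ ≤ T := (le_max_left _ _).trans hT
      have h1 := hT₁ T hTT₁
      have h2 : -B * Real.exp (4 * T) * Real.cos (4 * y) ≤ -c * Real.exp (4 * T) := by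
        rw [hc]
        have := mul_le_mul_of_nonneg_left hcos_y (mul_nonneg hB.le (Real.exp_pos (4 * T)).le)
        nlinarith
      have h3 : κ ≤ 1 := min_le_left _ _
      nlinarith
    · -- `T < 0`: drop the `e^{4T}` term
      rw [abs_of_neg hT0] at hT ⊢
      have h2 : -B * Real.exp (4 * T) * Real.cos (4 * y) ≤ 0 := by
        have := mul_nonneg (mul_nonneg hB.le (Real.exp_pos (4 * T)).le) hcos_y0
        linarith
      have h3 : κ ≤ 4 * s.re := min_le_right _ _
      nlinarith
  refine (Real.exp_le_exp.2 hexpo).trans ?_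
  -- `exp(-κ|T| + C₀) ≤ ε`
  have hT' : (C₀ - Real.log ε) / κ ≤ |T| := (le_max_right _ _).trans hT
  rw [div_le_iff₀ hκ0] at hT'
  calc Real.exp (-κ * |T| + C₀) ≤ Real.exp (Real.log ε) := Real.exp_le_exp.2 (by nlinarith)
    _ = ε := Real.exp_log hε

/-- **The `Γ`-identity for complex `b`** (`Re b > 0`, `Re s > 0`):
`∫_ℝ exp(−b e^{4w} + 4 s w) dw = ¼ Γ(s) b^{−s}` ("making the change of variables `r = b e^{4w}`
(and contour shifting or analytic continuation)", Rodgers–Tao, proof of FMP Lemma 7).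
[cite: RodgersTaoFMP2020, Lemma 2.4 proof (FMP Lemma 7 p. 15)] -/
theorem Gfun_eq {b s : ℂ} (hb : 0 < b.re) (hs : 0 < s.re) :
    Gfun b s = 1 / 4 * Complex.Gamma s * b ^ (-s) := by
  have hb0 : b ≠ 0 := fun h ↦ by rw [h] at hb; simp at hb
  have hnb : 0 < ‖b‖ := norm_pos_iff.2 hb0
  set θ : ℝ := Complex.arg b with hθ
  have hθlt : |θ| < π / 2 := Complex.abs_arg_lt_pi_div_two_iff.2 (Or.inl hb)
  -- the shift: `∫ gC(|b|,s)(x + 0·I) dx = ∫ gC(|b|,s)(x + (θ/4) I) dx`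
  have hshift : ∫ x : ℝ, gC (‖b‖ : ℂ) s ((x : ℂ) + (0 : ℝ) * I) =
      ∫ x : ℝ, gC (‖b‖ : ℂ) s ((x : ℂ) + ((θ / 4 : ℝ) : ℂ) * I) := by
    have hint0 : Integrable fun x : ℝ ↦ gC (‖b‖ : ℂ) s ((x : ℂ) + (0 : ℝ) * I) := by
      simp_rw [gC_ofReal]
      exact integrable_gInt (by simpa using hnb) hs
    have hintθ : Integrable fun x : ℝ ↦ gC (‖b‖ : ℂ) s ((x : ℂ) + ((θ / 4 : ℝ) : ℂ) * I) := by
      simp_rw [hθ, gC_shift]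
      exact (integrable_gInt hb hs).const_mul _
    have hdec : ∀ {y₁ y₂ : ℝ}, |y₁| ≤ |θ| / 4 → |y₂| ≤ |θ| / 4 → ∀ ε : ℝ, 0 < ε →
        ∃ T₀ : ℝ, ∀ T : ℝ, T₀ ≤ |T| → ∀ y ∈ Icc y₁ y₂,
          ‖gC (‖b‖ : ℂ) s ((T : ℂ) + (y : ℂ) * I)‖ ≤ ε := by
      intro y₁ y₂ h1 h2 ε hε
      obtain ⟨T₀, hT₀⟩ := gC_decay hnb hs (Y := |θ| / 4) (by positivity) (by linarith) hε
      exact ⟨T₀, fun T hT y hy ↦ hT₀ T hT y (abs_le.2 ⟨by linarith [hy.1, (abs_le.1 h1).1],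
        by linarith [hy.2, (abs_le.1 h2).2]⟩)⟩
    rcases le_or_gt 0 θ with hθ0 | hθ0
    · exact Literature.Analysis.Complex.integral_horizontal_eq_of_differentiableOn
        (F := gC (‖b‖ : ℂ) s) (by positivity) univ isOpen_univ (subset_univ _)
        (differentiable_gC _ _).differentiableOn hint0 hintθ
        (hdec (by simp; positivity) (by rw [abs_div, abs_of_nonneg hθ0]; norm_num))
    · exact (Literature.Analysis.Complex.integral_horizontal_eq_of_differentiableOn
        (F := gC (‖b‖ : ℂ) s) (by linarith : θ / 4 ≤ 0) univ isOpen_univ (subset_univ _)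
        (differentiable_gC _ _).differentiableOn hintθ hint0
        (hdec (by rw [abs_div, abs_of_neg hθ0]; norm_num)
          (by simp; positivity))).symm
  -- evaluate both sides
  simp_rw [gC_ofReal, hθ, gC_shift] at hshift
  rw [integral_const_mul] at hshift
  change Gfun (‖b‖ : ℂ) s = cexp (I * s * Complex.arg b) * Gfun b s at hshift
  rw [Gfun_ofReal hnb hs] at hshift
  -- `|b|^{-s} = e^{isθ} b^{-s}`
  have hcpow : ((‖b‖ : ℝ) : ℂ) ^ (-s) = cexp (I * s * Complex.arg b) * b ^ (-s) := by
    rw [Complex.cpow_def_of_ne_zero (by exact_mod_cast hnb.ne'), Complex.cpow_def_of_ne_zero hb0,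
      ← Complex.exp_add]
    congr 1
    have hlog1 : Complex.log ((‖b‖ : ℝ) : ℂ) = (Real.log ‖b‖ : ℂ) := (Complex.ofReal_log hnb.le).symm
    have hlog : Complex.log b = (Real.log ‖b‖ : ℂ) + (Complex.arg b : ℂ) * I := by
      apply Complex.ext <;> simp [Complex.log_re, Complex.log_im]
    rw [hlog1, hlog]
    ring
  rw [hcpow] at hshift
  have hexp : cexp (I * s * Complex.arg b) ≠ 0 := Complex.exp_ne_zero _
  have h2 : cexp (I * s * Complex.arg b) * Gfun b s =
      cexp (I * s * Complex.arg b) * (1 / 4 * Complex.Gamma s * b ^ (-s)) := by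
    rw [← hshift]; ring
  exact mul_left_cancel₀ hexp h2

/-! ## 3. The Gaussian probability measure `μ` and Fubini -/

/-- The density `ρ_a(ξ) = (2/√(πa)) e^{−4ξ²/a}` of the Gaussian probability measure `μ` of
Rodgers–Tao's proof (mean `0`, variance `a/8`, `a = |t|`).
[cite: RodgersTaoFMP2020, Lemma 2.4 proof (FMP Lemma 7 p. 15)] -/
def rho (a ξ : ℝ) : ℝ := 2 / Real.sqrt (π * a) * Real.exp (-(4 / a) * ξ ^ 2)

/-- Helper (rho pos). [folklore] -/
private theorem rho_pos {a : ℝ} (ha : 0 < a) (ξ : ℝ) : 0 < rho a ξ := by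
  unfold rho; positivity

/-- Helper (continuous rho). [folklore] -/
private theorem continuous_rho (a : ℝ) : Continuous (rho a) := by
  unfold rho; fun_prop

/-- Helper (integrable rho). [folklore] -/
private theorem integrable_rho {a : ℝ} (ha : 0 < a) : Integrable (rho a) := by
  unfold rho
  exact (integrable_exp_neg_mul_sq (by positivity : 0 < 4 / a)).const_mul _

/-- Helper (integral rho). [cite: RodgersTaoFMP2020, Lemma 2.4 proof (FMP Lemma 7 p. 15)] -/
theorem integral_rho {a : ℝ} (ha : 0 < a) : ∫ ξ, rho a ξ = 1 := by
  unfold rho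
  rw [integral_const_mul, integral_gaussian]
  have hπa : 0 < π * a := by positivity
  rw [show π / (4 / a) = (π * a) / 4 by field_simp, Real.sqrt_div' _ (by norm_num : (0:ℝ) ≤ 4),
    show Real.sqrt 4 = 2 by rw [show (4:ℝ) = 2 ^ 2 by norm_num, Real.sqrt_sq (by norm_num)]]
  have : Real.sqrt (π * a) ≠ 0 := (Real.sqrt_pos.2 hπa).ne'
  field_simp

/-- `e^{−a w²} = ∫ ρ_a(ξ) e^{4iξw} dξ` ("writing `e^{tw²} = ∫ e^{4iξw} dμ(ξ)`", `t = −a`).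
[cite: RodgersTaoFMP2020, Lemma 2.4 proof (FMP Lemma 7 p. 15)] -/
theorem gaussian_rep {a : ℝ} (ha : 0 < a) (w : ℝ) :
    ∫ ξ : ℝ, (rho a ξ : ℂ) * cexp (4 * I * ξ * w) = cexp (-(a : ℂ) * (w : ℂ) ^ 2) := by
  have hb : (-(4 / a : ℝ) : ℂ).re < 0 := by
    simp only [Complex.neg_re, Complex.ofReal_re]
    have : 0 < 4 / a := by positivity
    linarith
  have h := integral_cexp_quadratic hb (4 * I * w) 0
  have hfun : (fun ξ : ℝ ↦ (rho a ξ : ℂ) * cexp (4 * I * ξ * w)) = fun ξ : ℝ ↦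
      (2 / Real.sqrt (π * a) : ℝ) * cexp (-(4 / a : ℝ) * (ξ : ℂ) ^ 2 + 4 * I * w * ξ + 0) := by
    funext ξ
    rw [rho, Complex.ofReal_mul, mul_assoc, Complex.ofReal_exp, ← Complex.exp_add]
    congr 2
    push_cast
    ring
  rw [hfun, integral_const_mul, h]
  -- `(π / (4/a))^{1/2} = √(π a)/2` and the exponent is `-a w²`
  have hπa : 0 < π * a := by positivity
  have hsq : ((π : ℂ) / -(-(4 / a : ℝ) : ℂ)) ^ (1 / 2 : ℂ) = ((Real.sqrt (π * a) / 2 : ℝ) : ℂ) := by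
    have e1 : ((π : ℂ) / -(-(4 / a : ℝ) : ℂ)) = ((π * a / 4 : ℝ) : ℂ) := by
      push_cast
      field_simp
    rw [e1, show (1 / 2 : ℂ) = ((1 / 2 : ℝ) : ℂ) by push_cast; ring, ← Complex.ofReal_cpow (by positivity)]
    congr 1
    rw [← Real.sqrt_eq_rpow, Real.sqrt_div' _ (by norm_num : (0:ℝ) ≤ 4),
      show Real.sqrt 4 = 2 by rw [show (4:ℝ) = 2 ^ 2 by norm_num, Real.sqrt_sq (by norm_num)]]
  rw [hsq]
  have hexp : cexp (0 - (4 * I * (w : ℂ)) ^ 2 / (4 * (-(4 / a : ℝ) : ℂ))) = cexp (-(a : ℂ) * (w : ℂ) ^ 2) := by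
    congr 1
    have ha0 : (a : ℂ) ≠ 0 := by exact_mod_cast ha.ne'
    push_cast
    field_simp
    rw [Complex.I_sq]
    ring
  rw [hexp, ← mul_assoc]
  have hne : Real.sqrt (π * a) ≠ 0 := (Real.sqrt_pos.2 hπa).ne'
  have : ((2 / Real.sqrt (π * a) : ℝ) : ℂ) * ((Real.sqrt (π * a) / 2 : ℝ) : ℂ) = 1 := by
    rw [← Complex.ofReal_mul]
    rw [show 2 / Real.sqrt (π * a) * (Real.sqrt (π * a) / 2) = 1 by field_simp]
    simp
  rw [this, one_mul]

/-- `e^{4iξw} · exp(−b e^{4w} + 4bw) = exp(−b e^{4w} + 4(b + iξ)w)`. [folklore] -/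
private theorem cexp_mul_gInt (b : ℂ) (ξ w : ℝ) :
    cexp (4 * I * ξ * w) * gInt b b w = gInt b (b + ξ * I) w := by
  rw [gInt, gInt, ← Complex.exp_add]
  congr 1
  ring

/-- The joint integrand `Φ(w, ξ) = ρ_a(ξ) e^{4iξw} exp(−b e^{4w} + 4bw)` of the Fubini step.
[folklore] -/
def Phi (a : ℝ) (b : ℂ) (w ξ : ℝ) : ℂ := (rho a ξ : ℂ) * cexp (4 * I * ξ * w) * gInt b b w

/-- `Φ` is integrable on `ℝ × ℝ` (dominated by `|gInt b b w| · ρ_a(ξ)`). [folklore] -/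
private theorem integrable_Phi {a : ℝ} (ha : 0 < a) {b : ℂ} (hb : 0 < b.re) :
    Integrable (Function.uncurry (Phi a b)) (volume.prod volume) := by
  have hdom : Integrable (fun p : ℝ × ℝ ↦ ‖gInt b b p.1‖ * rho a p.2) (volume.prod volume) :=
    ((integrable_gInt hb hb).norm.mul_prod (integrable_rho ha))
  refine hdom.mono' ?_ (Filter.Eventually.of_forall fun p ↦ ?_)
  · have hc : Continuous (Function.uncurry (Phi a b)) := by
      unfold Phi
      simp only [Function.uncurry_def]
      exact ((Complex.continuous_ofReal.comp ((continuous_rho a).comp continuous_snd)).mul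
        (by fun_prop)).mul ((continuous_gInt b b).comp continuous_fst)
    exact hc.aestronglyMeasurable
  · obtain ⟨w, ξ⟩ := p
    show ‖(rho a ξ : ℂ) * cexp (4 * I * ξ * w) * gInt b b w‖ ≤ ‖gInt b b w‖ * rho a ξ
    rw [norm_mul, norm_mul, Complex.norm_real, Real.norm_eq_abs, abs_of_pos (rho_pos ha ξ)]
    have : ‖cexp (4 * I * ξ * w)‖ = 1 := by
      rw [Complex.norm_exp]
      simp
    rw [this, mul_one, mul_comm]

/-- The inner `w`-integral of `Φ` is `ρ_a(ξ) G(b, b + iξ)`. [folklore] -/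
private theorem integral_Phi_left {a : ℝ} {b : ℂ} (ξ : ℝ) :
    ∫ w : ℝ, Phi a b w ξ = (rho a ξ : ℂ) * Gfun b (b + ξ * I) := by
  unfold Phi
  rw [Gfun, ← integral_const_mul]
  congr 1; funext w
  rw [mul_assoc, cexp_mul_gInt]

/-- The `ξ`-integrand `ξ ↦ ρ_a(ξ) G(b, b + iξ)` is integrable (Fubini). [folklore] -/
private theorem integrable_rho_mul_Gfun {a : ℝ} (ha : 0 < a) {b : ℂ} (hb : 0 < b.re) :
    Integrable fun ξ : ℝ ↦ (rho a ξ : ℂ) * Gfun b (b + ξ * I) := by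
  have h := (integrable_Phi ha hb).integral_prod_right
  refine h.congr (Filter.Eventually.of_forall fun ξ ↦ ?_)
  exact integral_Phi_left ξ

/-- **Fubini**: for `t = −a < 0` and `Re b > 0`,
`I_t(b, 4b) = ∫ ρ_a(ξ) · G(b, b + iξ) dξ`.
[cite: RodgersTaoFMP2020, Lemma 2.4 proof (FMP Lemma 7 p. 15)] -/
theorem rodgersTaoI_eq_integral_Gfun {a : ℝ} (ha : 0 < a) {b : ℂ} (hb : 0 < b.re) :
    rodgersTaoI (-a) b (4 * b) = ∫ ξ : ℝ, (rho a ξ : ℂ) * Gfun b (b + ξ * I) := by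
  -- the integrand of `I_t` is `e^{-a w²} · gInt b b w`
  have hI : rodgersTaoI (-a) b (4 * b) = ∫ w : ℝ, cexp (-(a : ℂ) * (w : ℂ) ^ 2) * gInt b b w := by
    rw [rodgersTaoI]
    congr 1; funext w
    rw [gInt, ← Complex.exp_add]
    congr 1; push_cast; ring
  rw [hI]
  simp_rw [← gaussian_rep ha, ← integral_mul_const]
  have hswap := MeasureTheory.integral_integral_swap (integrable_Phi ha hb)
  simp only [Phi] at hswap
  rw [hswap]
  congr 1; funext ξ
  exact integral_Phi_left (a := a) (b := b) ξ

/-- The `ξ`-integrand after Fubini and the `Γ`-identity: for `Re b > 0`,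
`I_{−a}(b, 4b) = ∫ ρ_a(ξ) · ¼ Γ(b + iξ) b^{−(b+iξ)} dξ`.
[cite: RodgersTaoFMP2020, Lemma 2.4 proof (FMP Lemma 7 p. 15)] -/
theorem rodgersTaoI_eq_integral_Gamma {a : ℝ} (ha : 0 < a) {b : ℂ} (hb : 0 < b.re) :
    rodgersTaoI (-a) b (4 * b) =
      ∫ ξ : ℝ, (rho a ξ : ℂ) * (1 / 4 * Complex.Gamma (b + ξ * I) * b ^ (-(b + ξ * I))) := by
  rw [rodgersTaoI_eq_integral_Gfun ha hb]
  congr 1; funext ξ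
  rw [Gfun_eq hb (by simpa using hb)]

/-! ## 4. Stirling consequences: the main-region expansion and the crude bound -/

/-- Real Stirling upper bound: `Γ(σ) ≤ 4 σ^{σ−½} e^{−σ}` for `σ ≥ 1`
(from `GammaStirling.abs_log_norm_Gamma_sub_le` at a real point).
[cite: WhittakerWatson1927, §12.33] -/
theorem real_Gamma_le {σ : ℝ} (hσ : 1 ≤ σ) :
    Real.Gamma σ ≤ 4 * Real.exp ((σ - 1 / 2) * Real.log σ - σ) := by
  have hσ0 : 0 < σ := by linarith
  have hΓ0 : 0 < Real.Gamma σ := Real.Gamma_pos_of_pos hσ0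
  have h := abs_log_norm_Gamma_sub_le (w := (σ : ℂ)) (by simpa using hσ0)
  rw [Complex.Gamma_ofReal, Complex.norm_real, Real.norm_eq_abs, abs_of_pos hΓ0,
    Complex.norm_real, Real.norm_eq_abs, abs_of_pos hσ0, Complex.ofReal_re, Complex.ofReal_im,
    zero_mul, sub_zero] at h
  have h1 : Real.log (Real.Gamma σ) ≤ (σ - 1 / 2) * Real.log σ - σ +
      (Real.log (2 * π) / 2 + 1 / 12 * (1 / σ ^ 2 + π / (2 * σ))) := by
    linarith [(abs_le.1 h).2]
  have h2 : 1 / 12 * (1 / σ ^ 2 + π / (2 * σ)) ≤ 1 / 4 := by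
    have e1 : 1 / σ ^ 2 ≤ 1 := by rw [div_le_one (by positivity)]; nlinarith
    have e2 : π / (2 * σ) ≤ 2 := by
      rw [div_le_iff₀ (by positivity)]; linarith [Real.pi_lt_four]
    linarith
  -- `exp(log(2π)/2 + 1/4) ≤ 4`
  have h3 : Real.exp (Real.log (2 * π) / 2 + 1 / 4) ≤ 4 := by
    rw [Real.exp_add, show Real.log (2 * π) / 2 = Real.log (2 * π) * (1 / 2) by ring,
      ← Real.rpow_def_of_pos (by positivity), ← Real.sqrt_eq_rpow]
    have hs : Real.sqrt (2 * π) ≤ 3 := by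
      rw [Real.sqrt_le_left (by norm_num)]; linarith [Real.pi_lt_four]
    have he : Real.exp (1 / 4) ≤ 4 / 3 := by
      have := Real.exp_bound_div_one_sub_of_interval' (show (0:ℝ) < 1 / 4 by norm_num)
        (by norm_num)
      linarith [show (1 : ℝ) / (1 - 1 / 4) = 4 / 3 by norm_num]
    calc Real.sqrt (2 * π) * Real.exp (1 / 4) ≤ 3 * (4 / 3) :=
          mul_le_mul hs he (Real.exp_pos _).le (by norm_num)
      _ = 4 := by norm_num
  calc Real.Gamma σ = Real.exp (Real.log (Real.Gamma σ)) := (Real.exp_log hΓ0).symm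
    _ ≤ Real.exp ((σ - 1 / 2) * Real.log σ - σ + (Real.log (2 * π) / 2 + 1 / 4)) :=
        Real.exp_le_exp.2 (by linarith)
    _ = Real.exp ((σ - 1 / 2) * Real.log σ - σ) * Real.exp (Real.log (2 * π) / 2 + 1 / 4) := by
        rw [Real.exp_add]
    _ ≤ Real.exp ((σ - 1 / 2) * Real.log σ - σ) * 4 :=
        mul_le_mul_of_nonneg_left h3 (Real.exp_pos _).le
    _ = 4 * Real.exp ((σ - 1 / 2) * Real.log σ - σ) := by ring

/-- **Crude bound** (the tail estimate of the printed proof): for `Re b ≥ 1` and every real `ξ`,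
`‖Γ(b + iξ) · b^{−(b+iξ)}‖ ≤ 4 e^{−Re b} exp((π/2)(‖b‖ + |ξ|))`
("`|exp(−(b+iξ)log b)| ≤ exp(−Re b log|b| + (π/2)(|b| + |ξ|))` and
`|Γ(b+iξ)| ≤ Γ(Re b) ≤ exp(Re b log|b| − Re b)`").
[cite: RodgersTaoFMP2020, Lemma 2.4 proof (FMP Lemma 7 p. 16)] -/
theorem crude_bound {b : ℂ} (hb : 1 ≤ b.re) (ξ : ℝ) :
    ‖Complex.Gamma (b + ξ * I) * b ^ (-(b + ξ * I))‖ ≤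
      4 * Real.exp (-b.re) * Real.exp (π / 2 * (‖b‖ + |ξ|)) := by
  have hb0 : b ≠ 0 := by rintro rfl; norm_num at hb
  set σ : ℝ := b.re with hσ_def
  have hσ0 : 0 < σ := by linarith
  have hnb : 0 < ‖b‖ := norm_pos_iff.2 hb0
  have hσb : σ ≤ ‖b‖ := (le_abs_self _).trans (Complex.abs_re_le_norm b)
  -- `|Γ(b+iξ)| ≤ Γ(σ) ≤ 4 σ^{σ-1/2} e^{-σ}`
  have hΓ : ‖Complex.Gamma (b + ξ * I)‖ ≤ 4 * Real.exp ((σ - 1 / 2) * Real.log σ - σ) := by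
    have h1 : (b + ξ * I).re = σ := by simp [hσ_def]
    have h2 := norm_Gamma_le_Gamma_re (s := b + ξ * I) (by rw [h1]; exact hσ0)
    rw [h1] at h2
    exact h2.trans (real_Gamma_le hb)
  -- `|b^{-s}| = |b|^{-σ} exp(arg b · (Im b + ξ))`
  have hθ : |Complex.arg b| ≤ π / 2 :=
    (Complex.abs_arg_lt_pi_div_two_iff.2 (Or.inl (by linarith : 0 < b.re))).le
  have hpow : ‖b ^ (-(b + ξ * I))‖ ≤ Real.exp (-σ * Real.log ‖b‖) * Real.exp (π / 2 * (‖b‖ + |ξ|)) := by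
    rw [Complex.norm_cpow_of_ne_zero hb0, Real.rpow_def_of_pos hnb, div_eq_mul_inv, ← Real.exp_neg]
    have hre : (-(b + ξ * I)).re = -σ := by simp [hσ_def]
    have him : (-(b + ξ * I)).im = -(b.im + ξ) := by simp
    rw [hre, him, show Real.log ‖b‖ * -σ = -σ * Real.log ‖b‖ by ring]
    refine mul_le_mul_of_nonneg_left (Real.exp_le_exp.2 ?_) (Real.exp_pos _).le
    have h1 : |b.im| ≤ ‖b‖ := Complex.abs_im_le_norm b
    have h2 : -(Complex.arg b * -(b.im + ξ)) = Complex.arg b * (b.im + ξ) := by ring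
    rw [h2]
    calc Complex.arg b * (b.im + ξ) ≤ |Complex.arg b * (b.im + ξ)| := le_abs_self _
      _ = |Complex.arg b| * |b.im + ξ| := abs_mul _ _
      _ ≤ (π / 2) * (|b.im| + |ξ|) := mul_le_mul hθ (abs_add_le _ _) (abs_nonneg _) (by positivity)
      _ ≤ π / 2 * (‖b‖ + |ξ|) := by gcongr
  -- combine: `σ^{σ-1/2} |b|^{-σ} ≤ 1`
  have hkey : Real.exp ((σ - 1 / 2) * Real.log σ - σ) * Real.exp (-σ * Real.log ‖b‖) ≤
      Real.exp (-σ) := by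
    rw [← Real.exp_add]
    refine Real.exp_le_exp.2 ?_
    have hl1 : 0 ≤ Real.log σ := Real.log_nonneg hb
    have hl2 : Real.log σ ≤ Real.log ‖b‖ := Real.log_le_log hσ0 hσb
    nlinarith
  calc ‖Complex.Gamma (b + ξ * I) * b ^ (-(b + ξ * I))‖
      = ‖Complex.Gamma (b + ξ * I)‖ * ‖b ^ (-(b + ξ * I))‖ := norm_mul _ _
    _ ≤ (4 * Real.exp ((σ - 1 / 2) * Real.log σ - σ)) *
        (Real.exp (-σ * Real.log ‖b‖) * Real.exp (π / 2 * (‖b‖ + |ξ|))) :=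
        mul_le_mul hΓ hpow (norm_nonneg _) (by positivity)
    _ = 4 * (Real.exp ((σ - 1 / 2) * Real.log σ - σ) * Real.exp (-σ * Real.log ‖b‖)) *
        Real.exp (π / 2 * (‖b‖ + |ξ|)) := by ring
    _ ≤ 4 * Real.exp (-σ) * Real.exp (π / 2 * (‖b‖ + |ξ|)) := by gcongr

/-- `Log(b(1+u)) = Log b + Log(1+u)` for `Re b ≥ 0`, `b ≠ 0`, `‖u‖ < 1` (no branch crossing).
[folklore] -/
private theorem log_mul_one_add {b u : ℂ} (hb : 0 ≤ b.re) (hb0 : b ≠ 0) (hu : ‖u‖ < 1) :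
    Complex.log (b * (1 + u)) = Complex.log b + Complex.log (1 + u) := by
  have hu1 : 0 < (1 + u).re := by
    have h1 : |u.re| ≤ ‖u‖ := Complex.abs_re_le_norm u
    rw [Complex.add_re, Complex.one_re]
    linarith [neg_abs_le u.re]
  have hu0 : 1 + u ≠ 0 := fun h ↦ by rw [h] at hu1; simp at hu1
  rw [Complex.log_mul_eq_add_log_iff hb0 hu0]
  have h1 : |Complex.arg (1 + u)| < π / 2 := Complex.abs_arg_lt_pi_div_two_iff.2 (Or.inl hu1)
  have h2 : Complex.arg b ≤ π / 2 := Complex.arg_le_pi_div_two_iff.2 (Or.inl hb)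
  have h3 : -(π / 2) ≤ Complex.arg b := Complex.neg_pi_div_two_le_arg_iff.2 (Or.inl hb)
  constructor
  · linarith [(abs_lt.1 h1).1]
  · linarith [(abs_lt.1 h1).2]

/-- **Main-region expansion** ("by applying Stirling's approximation … substituting these
expressions into the integrand"): for `Re b ≥ 1` and `|ξ| ≤ ‖b‖/2` there is `R` with
`‖R‖ ≤ 3(ξ² + 1)/‖b‖` and `Γ(b+iξ) b^{−(b+iξ)} = √(2π) e^{−b} b^{−1/2} e^{R}`. Here
`R = b[(1+u)Log(1+u) − u] − ½Log(1+u) + E`, `u = iξ/b`, with `E` the Stirling error.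
[cite: RodgersTaoFMP2020, Lemma 2.4 proof (FMP Lemma 7 p. 15)] -/
theorem main_expansion {b : ℂ} (hb : 1 ≤ b.re) {ξ : ℝ} (hξ : |ξ| ≤ ‖b‖ / 2) :
    ∃ R : ℂ, ‖R‖ ≤ 3 * (ξ ^ 2 + 1) / ‖b‖ ∧
      Complex.Gamma (b + ξ * I) * b ^ (-(b + ξ * I)) =
        (Real.sqrt (2 * π) : ℂ) * cexp (-b) * b ^ (-(1 / 2 : ℂ)) * cexp R := by
  have hb0 : b ≠ 0 := by rintro rfl; norm_num at hb
  set s : ℂ := b + ξ * I with hs_def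
  have hnb : 0 < ‖b‖ := norm_pos_iff.2 hb0
  have hnb1 : 1 ≤ ‖b‖ := hb.trans ((le_abs_self _).trans (Complex.abs_re_le_norm b))
  have hs_re : 1 ≤ s.re := by simpa [hs_def] using hb
  set u : ℂ := (ξ : ℂ) * I / b with hu_def
  have hu_norm : ‖u‖ = |ξ| / ‖b‖ := by
    rw [hu_def, norm_div, norm_mul, Complex.norm_real, Complex.norm_I, mul_one, Real.norm_eq_abs]
  have hu_half : ‖u‖ ≤ 1 / 2 := by
    rw [hu_norm, div_le_iff₀ hnb]; linarith
  have hu_lt : ‖u‖ < 1 := by linarith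
  have hiξ : (ξ : ℂ) * I = b * u := by rw [hu_def, mul_div_cancel₀ _ hb0]
  have hsu : s = b * (1 + u) := by
    rw [hs_def, mul_add, mul_one, ← hiξ]
  -- norm of `s` from below
  have hs_norm : ‖b‖ / 2 ≤ ‖s‖ := by
    have h1 : ‖b‖ - ‖(ξ : ℂ) * I‖ ≤ ‖s‖ := by
      have := norm_sub_norm_le b (-((ξ : ℂ) * I))
      rwa [norm_neg, sub_neg_eq_add, ← hs_def] at this
    have h2 : ‖(ξ : ℂ) * I‖ = |ξ| := by
      rw [norm_mul, Complex.norm_real, Complex.norm_I, mul_one, Real.norm_eq_abs]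
    linarith
  -- Stirling at `s`
  obtain ⟨E, hE, hΓ⟩ := exists_Gamma_eq_exp_stirling_of_one_le_re hs_re
  have hE' : ‖E‖ ≤ 2 / ‖b‖ := by
    refine hE.trans ?_
    rw [div_le_div_iff₀ (by linarith) hnb]; linarith
  -- the remainder
  set R : ℂ := b * ((1 + u) * Complex.log (1 + u) - u) - 1 / 2 * Complex.log (1 + u) + E with hR
  refine ⟨R, ?_, ?_⟩
  · -- the bound `‖R‖ ≤ 3(ξ²+1)/‖b‖`
    have hL1 : ‖Complex.log (1 + u) - u‖ ≤ ‖u‖ ^ 2 := by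
      refine (Complex.norm_log_one_add_sub_self_le hu_lt).trans ?_
      have : (1 - ‖u‖)⁻¹ ≤ 2 := by
        rw [inv_le_comm₀ (by linarith) (by norm_num)]; linarith
      calc ‖u‖ ^ 2 * (1 - ‖u‖)⁻¹ / 2 ≤ ‖u‖ ^ 2 * 2 / 2 := by gcongr
        _ = ‖u‖ ^ 2 := by ring
    have hL2 : ‖Complex.log (1 + u)‖ ≤ 3 / 2 * ‖u‖ := Complex.norm_log_one_add_half_le_self hu_half
    have hA : ‖(1 + u) * Complex.log (1 + u) - u‖ ≤ 5 / 2 * ‖u‖ ^ 2 := by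
      have e : (1 + u) * Complex.log (1 + u) - u =
          (Complex.log (1 + u) - u) + u * Complex.log (1 + u) := by ring
      rw [e]
      refine (norm_add_le _ _).trans ?_
      rw [norm_mul]
      nlinarith [norm_nonneg u, mul_le_mul_of_nonneg_left hL2 (norm_nonneg u)]
    have hB : ‖b * ((1 + u) * Complex.log (1 + u) - u)‖ ≤ 5 / 2 * ξ ^ 2 / ‖b‖ := by
      rw [norm_mul]
      calc ‖b‖ * ‖(1 + u) * Complex.log (1 + u) - u‖ ≤ ‖b‖ * (5 / 2 * ‖u‖ ^ 2) :=
            mul_le_mul_of_nonneg_left hA (norm_nonneg _)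
        _ = 5 / 2 * ξ ^ 2 / ‖b‖ := by rw [hu_norm, div_pow, sq_abs]; field_simp
    have hC : ‖(1 / 2 : ℂ) * Complex.log (1 + u)‖ ≤ 3 / 4 * |ξ| / ‖b‖ := by
      rw [norm_mul, show ‖(1 / 2 : ℂ)‖ = 1 / 2 by norm_num]
      calc 1 / 2 * ‖Complex.log (1 + u)‖ ≤ 1 / 2 * (3 / 2 * ‖u‖) :=
            mul_le_mul_of_nonneg_left hL2 (by norm_num)
        _ = 3 / 4 * |ξ| / ‖b‖ := by rw [hu_norm]; ring
    have hD : 3 / 4 * |ξ| ≤ 1 / 2 * ξ ^ 2 + 1 := by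
      nlinarith [sq_nonneg (|ξ| - 3 / 4), sq_abs ξ, abs_nonneg ξ]
    calc ‖R‖ ≤ ‖b * ((1 + u) * Complex.log (1 + u) - u)‖ + ‖(1 / 2 : ℂ) * Complex.log (1 + u)‖ + ‖E‖ := by
          rw [hR]; exact (norm_add_le _ _).trans (add_le_add (norm_sub_le _ _) le_rfl)
      _ ≤ 5 / 2 * ξ ^ 2 / ‖b‖ + 3 / 4 * |ξ| / ‖b‖ + 2 / ‖b‖ := add_le_add (add_le_add hB hC) hE'
      _ = (5 / 2 * ξ ^ 2 + 3 / 4 * |ξ| + 2) / ‖b‖ := by ring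
      _ ≤ 3 * (ξ ^ 2 + 1) / ‖b‖ := by
          apply div_le_div_of_nonneg_right _ hnb.le; linarith
  · -- the identity
    have hlog_s : Complex.log s = Complex.log b + Complex.log (1 + u) := by
      rw [hsu]; exact log_mul_one_add (by linarith) hb0 hu_lt
    rw [hΓ]
    -- write all powers as exponentials
    rw [Complex.cpow_def_of_ne_zero hb0, Complex.cpow_def_of_ne_zero hb0]
    rw [mul_assoc, ← Complex.exp_add, mul_assoc, mul_assoc, ← Complex.exp_add, ← Complex.exp_add]
    congr 2
    rw [hlog_s, hR]
    have : -s = -b - b * u := by rw [hsu]; ring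
    rw [this, hsu]
    ring

/-! ## 5. Gaussian bookkeeping -/

/-- The weights `ρ_{a,k}(ξ) = (2/√(πa)) e^{−(k/a)ξ²}` (`ρ_a = ρ_{a,4}`). [folklore] -/
def rhoK (a k ξ : ℝ) : ℝ := 2 / Real.sqrt (π * a) * Real.exp (-(k / a) * ξ ^ 2)

/-- Helper (rho eq rhoK). [folklore] -/
private theorem rho_eq_rhoK (a ξ : ℝ) : rho a ξ = rhoK a 4 ξ := rfl

/-- Helper (rhoK nonneg). [folklore] -/
private theorem rhoK_nonneg (a k ξ : ℝ) : 0 ≤ rhoK a k ξ := by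
  unfold rhoK; positivity

/-- Helper (continuous rhoK). [folklore] -/
private theorem continuous_rhoK (a k : ℝ) : Continuous (rhoK a k) := by
  unfold rhoK; fun_prop

/-- Helper (integrable rhoK). [folklore] -/
private theorem integrable_rhoK {a k : ℝ} (ha : 0 < a) (hk : 0 < k) : Integrable (rhoK a k) := by
  unfold rhoK
  exact (integrable_exp_neg_mul_sq (by positivity : 0 < k / a)).const_mul _

/-- `∫ ρ_{a,k} = 2/√k`. [folklore] -/
private theorem integral_rhoK {a k : ℝ} (ha : 0 < a) (hk : 0 < k) : ∫ ξ, rhoK a k ξ = 2 / Real.sqrt k := by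
  unfold rhoK
  rw [integral_const_mul, integral_gaussian]
  have hπa : 0 < π * a := by positivity
  rw [show π / (k / a) = (π * a) / k by field_simp, Real.sqrt_div' _ hk.le]
  have : Real.sqrt (π * a) ≠ 0 := (Real.sqrt_pos.2 hπa).ne'
  field_simp

/-- `ξ² ρ_{a,4}(ξ) ≤ (a/2) ρ_{a,2}(ξ)` (from `x ≤ e^x` with `x = 2ξ²/a`). [folklore] -/
private theorem sq_mul_rho_le {a : ℝ} (ha : 0 < a) (ξ : ℝ) : ξ ^ 2 * rhoK a 4 ξ ≤ a / 2 * rhoK a 2 ξ := by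
  unfold rhoK
  have hc : 0 ≤ 2 / Real.sqrt (π * a) := by positivity
  -- `ξ² e^{-4ξ²/a} ≤ (a/2) e^{-2ξ²/a}` iff `(2ξ²/a) e^{-2ξ²/a} ≤ 1`
  have key : ξ ^ 2 * Real.exp (-(4 / a) * ξ ^ 2) ≤ a / 2 * Real.exp (-(2 / a) * ξ ^ 2) := by
    have h1 : 2 * ξ ^ 2 / a ≤ Real.exp (2 * ξ ^ 2 / a) := by
      linarith [Real.add_one_le_exp (2 * ξ ^ 2 / a)]
    have h2 : Real.exp (-(4 / a) * ξ ^ 2) = Real.exp (-(2 / a) * ξ ^ 2) * (Real.exp (2 * ξ ^ 2 / a))⁻¹ := by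
      rw [← Real.exp_neg, ← Real.exp_add]; congr 1; ring
    rw [h2]
    have h3 : 0 < Real.exp (2 * ξ ^ 2 / a) := Real.exp_pos _
    rw [← mul_assoc, mul_inv_le_iff₀ h3]
    have h4 : ξ ^ 2 = a / 2 * (2 * ξ ^ 2 / a) := by field_simp
    calc ξ ^ 2 * Real.exp (-(2 / a) * ξ ^ 2) = a / 2 * Real.exp (-(2 / a) * ξ ^ 2) * (2 * ξ ^ 2 / a) := by
          field_simp
      _ ≤ a / 2 * Real.exp (-(2 / a) * ξ ^ 2) * Real.exp (2 * ξ ^ 2 / a) := by gcongr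
  calc ξ ^ 2 * (2 / Real.sqrt (π * a) * Real.exp (-(4 / a) * ξ ^ 2))
      = 2 / Real.sqrt (π * a) * (ξ ^ 2 * Real.exp (-(4 / a) * ξ ^ 2)) := by ring
    _ ≤ 2 / Real.sqrt (π * a) * (a / 2 * Real.exp (-(2 / a) * ξ ^ 2)) :=
        mul_le_mul_of_nonneg_left key hc
    _ = a / 2 * (2 / Real.sqrt (π * a) * Real.exp (-(2 / a) * ξ ^ 2)) := by ring

/-- Tail manipulation of the Gaussian weight: if `ξ²/a ≥ B` and `(π/2)|ξ| ≤ ξ²/a` then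
`ρ_{a,4}(ξ) e^{(π/2)|ξ|} ≤ e^{−(5/2)B} ρ_{a,1/2}(ξ)`. [folklore] -/
private theorem rho_mul_exp_tail_le {a B ξ : ℝ} (hB : B ≤ ξ ^ 2 / a) (hπ : π / 2 * |ξ| ≤ ξ ^ 2 / a) :
    rhoK a 4 ξ * Real.exp (π / 2 * |ξ|) ≤ Real.exp (-(5 / 2) * B) * rhoK a (1 / 2) ξ := by
  unfold rhoK
  have hc : 0 ≤ 2 / Real.sqrt (π * a) := by
    rcases le_or_gt (π * a) 0 with h | h
    · rw [Real.sqrt_eq_zero'.2 h]; simp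
    · positivity
  rw [mul_assoc, mul_left_comm (Real.exp (-(5 / 2) * B)), ← Real.exp_add, ← Real.exp_add]
  refine mul_le_mul_of_nonneg_left (Real.exp_le_exp.2 ?_) hc
  have : -(4 / a) * ξ ^ 2 = -(4 * (ξ ^ 2 / a)) := by ring
  have h2 : -(1 / 2 / a) * ξ ^ 2 = -(1 / 2 * (ξ ^ 2 / a)) := by ring
  rw [this, h2]
  linarith

/-- Second tail manipulation: if `ξ²/a ≥ B` then `ρ_{a,4}(ξ) ≤ e^{−2B} ρ_{a,2}(ξ)`. [folklore] -/
private theorem rho_tail_le {a B ξ : ℝ} (hB : B ≤ ξ ^ 2 / a) :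
    rhoK a 4 ξ ≤ Real.exp (-2 * B) * rhoK a 2 ξ := by
  unfold rhoK
  have hc : 0 ≤ 2 / Real.sqrt (π * a) := by
    rcases le_or_gt (π * a) 0 with h | h
    · rw [Real.sqrt_eq_zero'.2 h]; simp
    · positivity
  rw [mul_left_comm, ← Real.exp_add]
  refine mul_le_mul_of_nonneg_left (Real.exp_le_exp.2 ?_) hc
  have : -(4 / a) * ξ ^ 2 = -(4 * (ξ ^ 2 / a)) := by ring
  have h2 : -(2 / a) * ξ ^ 2 = -(2 * (ξ ^ 2 / a)) := by ring
  rw [this, h2]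
  linarith

/-- `e^{−c x} ≤ 4/(c² x²)` for `c, x > 0` (from `e^{y} ≥ 1 + y` at `y = cx/2`). [folklore] -/
private theorem exp_neg_le_inv_sq {c x : ℝ} (hc : 0 < c) (hx : 0 < x) :
    Real.exp (-(c * x)) ≤ 4 / (c ^ 2 * x ^ 2) := by
  have h1 : c * x / 2 ≤ Real.exp (c * x / 2) := by linarith [Real.add_one_le_exp (c * x / 2)]
  have h2 : (c * x / 2) ^ 2 ≤ Real.exp (c * x) := by
    have := pow_le_pow_left₀ (by positivity) h1 2
    rwa [← Real.exp_nat_mul, show ((2 : ℕ) : ℝ) * (c * x / 2) = c * x by push_cast; ring] at this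
  rw [Real.exp_neg, inv_le_comm₀ (Real.exp_pos _) (by positivity)]
  calc (4 / (c ^ 2 * x ^ 2))⁻¹ = (c * x / 2) ^ 2 := by field_simp; ring
    _ ≤ Real.exp (c * x) := h2

/-! ## 6. The estimate for large `‖b‖` -/

/-- The main term `M(b) = √(π/8) e^{−b} b^{−1/2}`.
[cite: RodgersTaoFMP2020, Lemma 2.4 eq. (30) (FMP Lemma 7 p. 15)] -/
def mainTerm (b : ℂ) : ℂ := (Real.sqrt (π / 8) : ℂ) * cexp (-b) * b ^ (-(1 / 2 : ℂ))

/-- `‖M(b)‖ = √(π/8) e^{−Re b} ‖b‖^{−1/2}`. [folklore] -/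
private theorem norm_mainTerm {b : ℂ} (hb0 : b ≠ 0) :
    ‖mainTerm b‖ = Real.sqrt (π / 8) * Real.exp (-b.re) * (Real.sqrt ‖b‖)⁻¹ := by
  rw [mainTerm, norm_mul, norm_mul, Complex.norm_real, Real.norm_eq_abs,
    abs_of_nonneg (Real.sqrt_nonneg _), Complex.norm_exp, Complex.neg_re,
    Complex.norm_cpow_of_ne_zero hb0]
  congr 1
  have hre : (-(1 / 2 : ℂ)).re = -(1 / 2) := by norm_num
  have him : (-(1 / 2 : ℂ)).im = 0 := by norm_num
  rw [hre, him, mul_zero, Real.exp_zero, div_one, Real.rpow_neg (norm_nonneg _),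
    ← Real.sqrt_eq_rpow]

/-- Helper (sqrt two pi eq). [folklore] -/
private theorem sqrt_two_pi_eq : (Real.sqrt (2 * π) : ℂ) = 4 * (Real.sqrt (π / 8) : ℂ) := by
  rw [show (2 * π : ℝ) = 4 ^ 2 * (π / 8) by ring, Real.sqrt_mul' _ (by positivity),
    Real.sqrt_sq (by norm_num)]
  push_cast; ring

/-- `√(2π) e^{−b} b^{−1/2} = 4 M(b)`. [folklore] -/
private theorem sqrt_two_pi_mul_eq (b : ℂ) :
    (Real.sqrt (2 * π) : ℂ) * cexp (-b) * b ^ (-(1 / 2 : ℂ)) = 4 * mainTerm b := by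
  rw [sqrt_two_pi_eq, mainTerm]; ring

/-- The bounding function on the main region. [folklore] -/
def hOne (a : ℝ) (b : ℂ) (ξ : ℝ) : ℝ :=
  Real.sqrt (π / 8) * Real.exp (-b.re) * (Real.sqrt ‖b‖)⁻¹ * (3 * Real.exp (3 * a + 1) / ‖b‖) *
    (a / 2 * rhoK a 2 ξ + rhoK a 4 ξ)

/-- The bounding function on the tail. [folklore] -/
def hTwo (a : ℝ) (b : ℂ) (ξ : ℝ) : ℝ :=
  Real.exp (-b.re) * Real.exp (π / 2 * ‖b‖) * (Real.exp (-(5 / 2) * ‖b‖) * rhoK a (1 / 2) ξ) +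
    Real.sqrt (π / 8) * Real.exp (-b.re) * (Real.sqrt ‖b‖)⁻¹ * (Real.exp (-2 * ‖b‖) * rhoK a 2 ξ)

/-- Helper (hOne nonneg). [folklore] -/
private theorem hOne_nonneg (a : ℝ) (ha : 0 ≤ a) (b : ℂ) (ξ : ℝ) : 0 ≤ hOne a b ξ := by
  unfold hOne; positivity [rhoK_nonneg a 2 ξ, rhoK_nonneg a 4 ξ]

/-- Helper (hTwo nonneg). [folklore] -/
private theorem hTwo_nonneg (a : ℝ) (b : ℂ) (ξ : ℝ) : 0 ≤ hTwo a b ξ := by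
  unfold hTwo; positivity [rhoK_nonneg a (1 / 2) ξ, rhoK_nonneg a 2 ξ]

/-- **Pointwise bound on the main region** `ξ² ≤ a‖b‖` (`Re b ≥ 1`, `‖b‖ ≥ max(4a, 4)`):
`ρ_a(ξ) ‖¼Γ(s)b^{−s} − M‖ ≤ hOne a b ξ`. [folklore] -/
private theorem main_region_bound {a : ℝ} (ha : 0 < a) {b : ℂ} (hb : 1 ≤ b.re) (h4a : 4 * a ≤ ‖b‖)
    (h4 : 4 ≤ ‖b‖) {ξ : ℝ} (hreg : ξ ^ 2 ≤ a * ‖b‖) :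
    rho a ξ * ‖1 / 4 * Complex.Gamma (b + ξ * I) * b ^ (-(b + ξ * I)) - mainTerm b‖ ≤
      hOne a b ξ := by
  have hb0 : b ≠ 0 := by rintro rfl; norm_num at hb
  have hnb : 0 < ‖b‖ := norm_pos_iff.2 hb0
  have hρ := rho_pos ha ξ
  have hξ : |ξ| ≤ ‖b‖ / 2 := by
    have h1 : ξ ^ 2 ≤ (‖b‖ / 2) ^ 2 := by nlinarith
    nlinarith [sq_abs ξ, abs_nonneg ξ, hnb]
  obtain ⟨R, hR, hG⟩ := main_expansion hb hξ
  have hRL : ‖R‖ ≤ 3 * a + 1 := by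
    refine hR.trans ?_
    rw [div_le_iff₀ hnb]
    nlinarith [hreg, h4, ha]
  have hexpR : ‖cexp R - 1‖ ≤ ‖R‖ * Real.exp (3 * a + 1) := by
    have := Complex.norm_exp_sub_sum_le_norm_mul_exp R 1
    simp only [Finset.range_one, Finset.sum_singleton, pow_zero, Nat.factorial_zero,
      Nat.cast_one, div_one, pow_one] at this
    exact this.trans (mul_le_mul_of_nonneg_left (Real.exp_le_exp.2 hRL) (norm_nonneg _))
  have hsplit : 1 / 4 * Complex.Gamma (b + ξ * I) * b ^ (-(b + ξ * I)) - mainTerm b =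
      mainTerm b * (cexp R - 1) := by
    rw [mul_assoc (1 / 4 : ℂ), hG, sqrt_two_pi_mul_eq]; ring
  rw [hsplit, norm_mul, norm_mainTerm hb0]
  have hρR : rho a ξ * ‖R‖ ≤ 3 / ‖b‖ * (a / 2 * rhoK a 2 ξ + rhoK a 4 ξ) := by
    calc rho a ξ * ‖R‖ ≤ rho a ξ * (3 * (ξ ^ 2 + 1) / ‖b‖) := mul_le_mul_of_nonneg_left hR hρ.le
      _ = 3 / ‖b‖ * (ξ ^ 2 * rhoK a 4 ξ + rhoK a 4 ξ) := by rw [rho_eq_rhoK]; ring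
      _ ≤ 3 / ‖b‖ * (a / 2 * rhoK a 2 ξ + rhoK a 4 ξ) :=
          mul_le_mul_of_nonneg_left (add_le_add (sq_mul_rho_le ha ξ) le_rfl) (by positivity)
  unfold hOne
  set P : ℝ := Real.sqrt (π / 8) * Real.exp (-b.re) * (Real.sqrt ‖b‖)⁻¹ with hP
  have hP0 : 0 ≤ P := by positivity
  calc rho a ξ * (P * ‖cexp R - 1‖) = P * (rho a ξ * ‖cexp R - 1‖) := by ring
    _ ≤ P * (rho a ξ * (‖R‖ * Real.exp (3 * a + 1))) := by gcongr
    _ = P * Real.exp (3 * a + 1) * (rho a ξ * ‖R‖) := by ring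
    _ ≤ P * Real.exp (3 * a + 1) * (3 / ‖b‖ * (a / 2 * rhoK a 2 ξ + rhoK a 4 ξ)) := by gcongr
    _ = P * (3 * Real.exp (3 * a + 1) / ‖b‖) * (a / 2 * rhoK a 2 ξ + rhoK a 4 ξ) := by ring

/-- **Pointwise bound on the tail** `ξ² > a‖b‖` (`Re b ≥ 1`, `‖b‖ ≥ 4a`):
`ρ_a(ξ) ‖¼Γ(s)b^{−s} − M‖ ≤ hTwo a b ξ`. [folklore] -/
private theorem tail_bound {a : ℝ} (ha : 0 < a) {b : ℂ} (hb : 1 ≤ b.re) (h4a : 4 * a ≤ ‖b‖)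
    {ξ : ℝ} (hreg : a * ‖b‖ < ξ ^ 2) :
    rho a ξ * ‖1 / 4 * Complex.Gamma (b + ξ * I) * b ^ (-(b + ξ * I)) - mainTerm b‖ ≤
      hTwo a b ξ := by
  have hb0 : b ≠ 0 := by rintro rfl; norm_num at hb
  have hnb : 0 < ‖b‖ := norm_pos_iff.2 hb0
  have hsb : 0 < Real.sqrt ‖b‖ := Real.sqrt_pos.2 hnb
  have hρ := rho_pos ha ξ
  have hBξ : ‖b‖ ≤ ξ ^ 2 / a := by rw [le_div_iff₀ ha]; linarith
  have hξ2a : 2 * a ≤ |ξ| := by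
    have h1 : (2 * a) ^ 2 ≤ ξ ^ 2 := by nlinarith
    nlinarith [sq_abs ξ, abs_nonneg ξ, ha]
  have hπξ : π / 2 * |ξ| ≤ ξ ^ 2 / a := by
    rw [le_div_iff₀ ha]
    have hπ4 : π / 2 ≤ 2 := by linarith [Real.pi_lt_four]
    calc π / 2 * |ξ| * a ≤ 2 * |ξ| * a := by gcongr
      _ = |ξ| * (2 * a) := by ring
      _ ≤ |ξ| * |ξ| := by gcongr
      _ = ξ ^ 2 := by rw [← sq, sq_abs]
  have hcr := crude_bound hb ξ
  -- `ρ ‖¼ Γ b^{-s} − M‖ ≤ ¼ ρ ‖Γ b^{-s}‖ + ρ ‖M‖`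
  have h1 : ‖1 / 4 * Complex.Gamma (b + ξ * I) * b ^ (-(b + ξ * I)) - mainTerm b‖ ≤
      1 / 4 * ‖Complex.Gamma (b + ξ * I) * b ^ (-(b + ξ * I))‖ + ‖mainTerm b‖ := by
    refine (norm_sub_le _ _).trans ?_
    rw [mul_assoc, norm_mul, show ‖(1 / 4 : ℂ)‖ = 1 / 4 by norm_num]
  have e1 : rho a ξ * (1 / 4 * (4 * Real.exp (-b.re) * Real.exp (π / 2 * (‖b‖ + |ξ|)))) =
      Real.exp (-b.re) * Real.exp (π / 2 * ‖b‖) * (rhoK a 4 ξ * Real.exp (π / 2 * |ξ|)) := by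
    rw [rho_eq_rhoK, mul_add, Real.exp_add]; ring
  have e2 : rho a ξ * (Real.sqrt (π / 8) * Real.exp (-b.re) * (Real.sqrt ‖b‖)⁻¹) =
      Real.sqrt (π / 8) * Real.exp (-b.re) * (Real.sqrt ‖b‖)⁻¹ * rhoK a 4 ξ := by
    rw [rho_eq_rhoK]; ring
  unfold hTwo
  calc rho a ξ * ‖1 / 4 * Complex.Gamma (b + ξ * I) * b ^ (-(b + ξ * I)) - mainTerm b‖
      ≤ rho a ξ * (1 / 4 * ‖Complex.Gamma (b + ξ * I) * b ^ (-(b + ξ * I))‖ + ‖mainTerm b‖) :=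
        mul_le_mul_of_nonneg_left h1 hρ.le
    _ ≤ rho a ξ * (1 / 4 * (4 * Real.exp (-b.re) * Real.exp (π / 2 * (‖b‖ + |ξ|))) +
        ‖mainTerm b‖) := by gcongr
    _ = Real.exp (-b.re) * Real.exp (π / 2 * ‖b‖) * (rhoK a 4 ξ * Real.exp (π / 2 * |ξ|)) +
        Real.sqrt (π / 8) * Real.exp (-b.re) * (Real.sqrt ‖b‖)⁻¹ * rhoK a 4 ξ := by
        rw [mul_add, e1, norm_mainTerm hb0, e2]
    _ ≤ Real.exp (-b.re) * Real.exp (π / 2 * ‖b‖) * (Real.exp (-(5 / 2) * ‖b‖) * rhoK a (1 / 2) ξ) +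
        Real.sqrt (π / 8) * Real.exp (-b.re) * (Real.sqrt ‖b‖)⁻¹ *
          (Real.exp (-2 * ‖b‖) * rhoK a 2 ξ) :=
        add_le_add (mul_le_mul_of_nonneg_left (rho_mul_exp_tail_le hBξ hπξ) (by positivity))
          (mul_le_mul_of_nonneg_left (rho_tail_le hBξ) (by positivity))

/-- Helper (integrable hOne). [folklore] -/
private theorem integrable_hOne {a : ℝ} (ha : 0 < a) (b : ℂ) : Integrable (hOne a b) := by
  unfold hOne
  exact (((integrable_rhoK ha two_pos).const_mul _).add (integrable_rhoK ha four_pos)).const_mul _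

/-- Helper (integrable hTwo). [folklore] -/
private theorem integrable_hTwo {a : ℝ} (ha : 0 < a) (b : ℂ) : Integrable (hTwo a b) := by
  unfold hTwo
  exact (((integrable_rhoK ha one_half_pos).const_mul _).const_mul _).add
    (((integrable_rhoK ha two_pos).const_mul _).const_mul _)

/-- Helper (integral hOne). [folklore] -/
private theorem integral_hOne {a : ℝ} (ha : 0 < a) (b : ℂ) :
    ∫ ξ, hOne a b ξ = Real.sqrt (π / 8) * Real.exp (-b.re) * (Real.sqrt ‖b‖)⁻¹ *
      (3 * Real.exp (3 * a + 1) / ‖b‖) * (a / 2 * (2 / Real.sqrt 2) + 2 / Real.sqrt 4) := by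
  unfold hOne
  rw [integral_const_mul, integral_add ((integrable_rhoK ha two_pos).const_mul _)
    (integrable_rhoK ha four_pos), integral_const_mul, integral_rhoK ha two_pos,
    integral_rhoK ha four_pos]

/-- Helper (integral hTwo). [folklore] -/
private theorem integral_hTwo {a : ℝ} (ha : 0 < a) (b : ℂ) :
    ∫ ξ, hTwo a b ξ = Real.exp (-b.re) * Real.exp (π / 2 * ‖b‖) *
      (Real.exp (-(5 / 2) * ‖b‖) * (2 / Real.sqrt (1 / 2))) +
      Real.sqrt (π / 8) * Real.exp (-b.re) * (Real.sqrt ‖b‖)⁻¹ *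
        (Real.exp (-2 * ‖b‖) * (2 / Real.sqrt 2)) := by
  unfold hTwo
  rw [integral_add (((integrable_rhoK ha one_half_pos).const_mul _).const_mul _)
    (((integrable_rhoK ha two_pos).const_mul _).const_mul _), integral_const_mul,
    integral_const_mul, integral_const_mul, integral_const_mul,
    integral_rhoK ha one_half_pos, integral_rhoK ha two_pos]

/-- Numerics: `∫ hOne + ∫ hTwo ≤ (2e^{3a+1}(1+a) + 10) e^{−Re b}/(‖b‖√‖b‖)` for `‖b‖ ≥ 4`.
[folklore] -/
private theorem integral_hOne_add_hTwo_le {a : ℝ} (ha : 0 < a) {b : ℂ} (h4 : 4 ≤ ‖b‖) :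
    (∫ ξ, hOne a b ξ) + ∫ ξ, hTwo a b ξ ≤
      (2 * Real.exp (3 * a + 1) * (1 + a) + 10) * Real.exp (-b.re) / (‖b‖ * Real.sqrt ‖b‖) := by
  have hnb : 0 < ‖b‖ := by linarith
  have hsb : 0 < Real.sqrt ‖b‖ := Real.sqrt_pos.2 hnb
  rw [integral_hOne ha, integral_hTwo ha]
  set σ : ℝ := b.re
  set E : ℝ := Real.exp (-σ) / (‖b‖ * Real.sqrt ‖b‖) with hE
  have hE0 : 0 ≤ E := by positivity
  -- elementary constants
  have hs4 : Real.sqrt 4 = 2 := by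
    rw [show (4:ℝ) = 2 ^ 2 by norm_num, Real.sqrt_sq (by norm_num)]
  have hs2 : 1 ≤ Real.sqrt 2 := by
    rw [show (1:ℝ) = Real.sqrt 1 by simp]; exact Real.sqrt_le_sqrt (by norm_num)
  have hs12 : 2 / Real.sqrt (1 / 2) ≤ 3 := by
    rw [div_le_iff₀ (Real.sqrt_pos.2 (by norm_num))]
    have : (2 / 3 : ℝ) ≤ Real.sqrt (1 / 2) := by
      rw [Real.le_sqrt (by norm_num) (by norm_num)]; norm_num
    linarith
  have hsπ : Real.sqrt (π / 8) ≤ 2 / 3 := by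
    rw [Real.sqrt_le_left (by norm_num)]; nlinarith [Real.pi_lt_d2]
  have hsπ0 : 0 ≤ Real.sqrt (π / 8) := Real.sqrt_nonneg _
  have h1s2 : 1 / Real.sqrt 2 ≤ 1 := by rw [div_le_one (by positivity)]; exact hs2
  have hsq : Real.sqrt ‖b‖ * Real.sqrt ‖b‖ = ‖b‖ := Real.mul_self_sqrt hnb.le
  have hsb2 : 2 ≤ Real.sqrt ‖b‖ := by
    rw [show (2:ℝ) = Real.sqrt 4 by rw [hs4]]; exact Real.sqrt_le_sqrt h4
  -- `e^{(π/2)|b|} e^{-(5/2)|b|} ≤ 5/|b|²`, `e^{-2|b|} ≤ 1/|b|`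
  set c : ℝ := 5 / 2 - π / 2 with hc
  have hc9 : 9 / 10 ≤ c := by have := Real.pi_lt_d2; rw [hc]; linarith
  have hc0 : 0 < c := by linarith
  have hc2 : 81 / 100 ≤ c ^ 2 := by nlinarith
  have hexp1 : Real.exp (π / 2 * ‖b‖) * Real.exp (-(5 / 2) * ‖b‖) ≤ 5 / ‖b‖ ^ 2 := by
    rw [← Real.exp_add, show π / 2 * ‖b‖ + -(5 / 2) * ‖b‖ = -(c * ‖b‖) by rw [hc]; ring]
    refine (exp_neg_le_inv_sq hc0 hnb).trans ?_
    rw [div_le_div_iff₀ (by positivity) (by positivity)]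
    have hb2 : 0 < ‖b‖ ^ 2 := by positivity
    nlinarith
  have hexp2 : Real.exp (-2 * ‖b‖) ≤ 1 / ‖b‖ := by
    have h1 : ‖b‖ ≤ Real.exp (2 * ‖b‖) := by linarith [Real.add_one_le_exp (2 * ‖b‖)]
    rw [show -2 * ‖b‖ = -(2 * ‖b‖) by ring, Real.exp_neg, inv_le_comm₀ (Real.exp_pos _) (by positivity)]
    simpa using h1
  -- conversions to `E`
  have hconv1 : Real.exp (-σ) * (Real.sqrt ‖b‖)⁻¹ * (1 / ‖b‖) = E := by
    rw [hE]; field_simp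
  have hconv2 : Real.exp (-σ) * (5 / ‖b‖ ^ 2) ≤ 5 / 2 * E := by
    rw [hE]
    have h1 : 5 / ‖b‖ ^ 2 ≤ 5 / 2 / (‖b‖ * Real.sqrt ‖b‖) := by
      rw [div_le_div_iff₀ (by positivity) (by positivity)]
      have : ‖b‖ ^ 2 = ‖b‖ * Real.sqrt ‖b‖ * Real.sqrt ‖b‖ := by rw [mul_assoc, hsq, sq]
      rw [this]
      have h0 : 0 ≤ ‖b‖ * Real.sqrt ‖b‖ := by positivity
      nlinarith
    calc Real.exp (-σ) * (5 / ‖b‖ ^ 2) ≤ Real.exp (-σ) * (5 / 2 / (‖b‖ * Real.sqrt ‖b‖)) :=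
          mul_le_mul_of_nonneg_left h1 (Real.exp_pos _).le
      _ = 5 / 2 * (Real.exp (-σ) / (‖b‖ * Real.sqrt ‖b‖)) := by ring
  -- piece 1
  have hp1 : Real.sqrt (π / 8) * Real.exp (-σ) * (Real.sqrt ‖b‖)⁻¹ *
      (3 * Real.exp (3 * a + 1) / ‖b‖) * (a / 2 * (2 / Real.sqrt 2) + 2 / Real.sqrt 4) ≤
      2 * Real.exp (3 * a + 1) * (1 + a) * E := by
    rw [hs4, show (2:ℝ) / 2 = 1 by norm_num]
    have ha2 : a / 2 * (2 / Real.sqrt 2) + 1 ≤ a + 1 := by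
      have : a / 2 * (2 / Real.sqrt 2) = a * (1 / Real.sqrt 2) := by ring
      nlinarith
    have ha20 : 0 ≤ a / 2 * (2 / Real.sqrt 2) + 1 := by positivity
    have e : Real.sqrt (π / 8) * Real.exp (-σ) * (Real.sqrt ‖b‖)⁻¹ * (3 * Real.exp (3 * a + 1) / ‖b‖) =
        3 * Real.sqrt (π / 8) * Real.exp (3 * a + 1) * E := by
      rw [hE]; field_simp
    rw [e]
    have hX : 0 ≤ Real.exp (3 * a + 1) * E := by positivity
    calc 3 * Real.sqrt (π / 8) * Real.exp (3 * a + 1) * E * (a / 2 * (2 / Real.sqrt 2) + 1)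
        ≤ 3 * (2 / 3) * Real.exp (3 * a + 1) * E * (a + 1) := by gcongr
      _ = 2 * Real.exp (3 * a + 1) * (1 + a) * E := by ring
  -- piece 2
  have hp2 : Real.exp (-σ) * Real.exp (π / 2 * ‖b‖) *
      (Real.exp (-(5 / 2) * ‖b‖) * (2 / Real.sqrt (1 / 2))) ≤ 15 / 2 * E := by
    have e : Real.exp (-σ) * Real.exp (π / 2 * ‖b‖) * (Real.exp (-(5 / 2) * ‖b‖) * (2 / Real.sqrt (1 / 2))) =
        (2 / Real.sqrt (1 / 2)) * (Real.exp (-σ) * (Real.exp (π / 2 * ‖b‖) * Real.exp (-(5 / 2) * ‖b‖))) := by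
      ring
    rw [e]
    have h1 : Real.exp (-σ) * (Real.exp (π / 2 * ‖b‖) * Real.exp (-(5 / 2) * ‖b‖)) ≤ 5 / 2 * E :=
      (mul_le_mul_of_nonneg_left hexp1 (Real.exp_pos _).le).trans hconv2
    have h0 : 0 ≤ Real.exp (-σ) * (Real.exp (π / 2 * ‖b‖) * Real.exp (-(5 / 2) * ‖b‖)) := by positivity
    calc 2 / Real.sqrt (1 / 2) * (Real.exp (-σ) * (Real.exp (π / 2 * ‖b‖) * Real.exp (-(5 / 2) * ‖b‖)))
        ≤ 3 * (5 / 2 * E) := mul_le_mul hs12 h1 h0 (by norm_num)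
      _ = 15 / 2 * E := by ring
  -- piece 3
  have hp3 : Real.sqrt (π / 8) * Real.exp (-σ) * (Real.sqrt ‖b‖)⁻¹ *
      (Real.exp (-2 * ‖b‖) * (2 / Real.sqrt 2)) ≤ 2 * E := by
    have e : Real.sqrt (π / 8) * Real.exp (-σ) * (Real.sqrt ‖b‖)⁻¹ * (Real.exp (-2 * ‖b‖) * (2 / Real.sqrt 2)) =
        Real.sqrt (π / 8) * (2 / Real.sqrt 2) * (Real.exp (-σ) * (Real.sqrt ‖b‖)⁻¹ * Real.exp (-2 * ‖b‖)) := by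
      ring
    rw [e]
    have h1 : Real.exp (-σ) * (Real.sqrt ‖b‖)⁻¹ * Real.exp (-2 * ‖b‖) ≤ E := by
      rw [← hconv1]
      exact mul_le_mul_of_nonneg_left hexp2 (by positivity)
    have h0 : 0 ≤ Real.exp (-σ) * (Real.sqrt ‖b‖)⁻¹ * Real.exp (-2 * ‖b‖) := by positivity
    have h2 : 2 / Real.sqrt 2 ≤ 2 := by rw [div_le_iff₀ (by positivity)]; linarith
    calc Real.sqrt (π / 8) * (2 / Real.sqrt 2) * (Real.exp (-σ) * (Real.sqrt ‖b‖)⁻¹ * Real.exp (-2 * ‖b‖))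
        ≤ (2 / 3) * 2 * E := mul_le_mul (mul_le_mul hsπ h2 (by positivity) (by norm_num)) h1 h0
          (by positivity)
      _ ≤ 2 * E := by nlinarith
  have htot : 2 * Real.exp (3 * a + 1) * (1 + a) * E + 15 / 2 * E + 2 * E ≤
      (2 * Real.exp (3 * a + 1) * (1 + a) + 10) * Real.exp (-σ) / (‖b‖ * Real.sqrt ‖b‖) := by
    rw [mul_div_assoc, ← hE]; nlinarith
  linarith

/-- **The bound for `‖b‖ ≥ max(4a, 4)`** (`a = |t|`, `Re b ≥ 1`):
`‖I_{−a}(b,4b) − M(b)‖ ≤ (2 e^{3a+1}(1+a) + 10) e^{−Re b}/(‖b‖√‖b‖)`.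
[cite: RodgersTaoFMP2020, Lemma 2.4 eq. (30) (FMP Lemma 7 p. 15)] -/
theorem large_b_bound {a : ℝ} (ha : 0 < a) {b : ℂ} (hb : 1 ≤ b.re) (h4a : 4 * a ≤ ‖b‖)
    (h4 : 4 ≤ ‖b‖) :
    ‖rodgersTaoI (-a) b (4 * b) - mainTerm b‖ ≤
      (2 * Real.exp (3 * a + 1) * (1 + a) + 10) * Real.exp (-b.re) / (‖b‖ * Real.sqrt ‖b‖) := by
  have hbre : 0 < b.re := by linarith
  -- `I − M = ∫ ρ (G − M)`
  have hGint := integrable_rho_mul_Gfun ha hbre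
  have hMint : Integrable fun ξ : ℝ ↦ (rho a ξ : ℂ) * mainTerm b :=
    (integrable_rho ha).ofReal.mul_const _
  have hIM : rodgersTaoI (-a) b (4 * b) - mainTerm b =
      ∫ ξ : ℝ, (rho a ξ : ℂ) * (Gfun b (b + ξ * I) - mainTerm b) := by
    rw [rodgersTaoI_eq_integral_Gfun ha hbre]
    have hM1 : mainTerm b = ∫ ξ : ℝ, (rho a ξ : ℂ) * mainTerm b := by
      rw [integral_mul_const, integral_complex_ofReal, integral_rho ha]; simp
    conv_lhs => rw [hM1]
    rw [← integral_sub hGint hMint]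
    congr 1; funext ξ; ring
  -- pointwise bound
  have hpt : ∀ ξ : ℝ, ‖(rho a ξ : ℂ) * (Gfun b (b + ξ * I) - mainTerm b)‖ ≤ hOne a b ξ + hTwo a b ξ := by
    intro ξ
    rw [norm_mul, Complex.norm_real, Real.norm_eq_abs, abs_of_pos (rho_pos ha ξ),
      Gfun_eq hbre (by simpa using hbre)]
    by_cases hreg : ξ ^ 2 ≤ a * ‖b‖
    · exact (main_region_bound ha hb h4a h4 hreg).trans (le_add_of_nonneg_right (hTwo_nonneg a b ξ))
    · exact (tail_bound ha hb h4a (not_le.1 hreg)).trans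
        (le_add_of_nonneg_left (hOne_nonneg a ha.le b ξ))
  have hint12 : Integrable (fun ξ ↦ hOne a b ξ + hTwo a b ξ) :=
    (integrable_hOne ha b).add (integrable_hTwo ha b)
  have hbound := norm_integral_le_of_norm_le hint12 (Filter.Eventually.of_forall hpt)
  rw [integral_add (integrable_hOne ha b) (integrable_hTwo ha b)] at hbound
  rw [hIM]
  exact hbound.trans (integral_hOne_add_hTwo_le ha h4)

/-! ## 7. Small `‖b‖` ("the small `|b|` case of the lemma follows trivially"), and the theorem -/

/-- Helper (gInt ofReal). [folklore] -/
private theorem gInt_ofReal (σ w : ℝ) :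
    gInt (σ : ℂ) (σ : ℂ) w = ((Real.exp (-σ * Real.exp (4 * w) + 4 * σ * w) : ℝ) : ℂ) := by
  simp only [gInt, Complex.ofReal_exp, Complex.ofReal_add, Complex.ofReal_mul, Complex.ofReal_neg,
    Complex.ofReal_ofNat]

/-- `‖I_{−a}(b, 4b)‖ ≤ e^{−Re b}` for `a ≥ 0`, `Re b ≥ 1` (the integrand is dominated by
`exp(−σ e^{4w} + 4σw)`, `σ = Re b`, whose integral is `¼Γ(σ)σ^{−σ} ≤ σ^{−1/2}e^{−σ}`).
[cite: RodgersTaoFMP2020, Lemma 2.4 proof (FMP Lemma 7 p. 15)] -/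
theorem norm_rodgersTaoI_le {a : ℝ} (ha : 0 ≤ a) {b : ℂ} (hb : 1 ≤ b.re) :
    ‖rodgersTaoI (-a) b (4 * b)‖ ≤ Real.exp (-b.re) := by
  set σ : ℝ := b.re with hσ
  have hσ0 : 0 < σ := by linarith
  have hgi : Integrable (gInt (σ : ℂ) (σ : ℂ)) := integrable_gInt (by simpa using hσ0) (by simpa using hσ0)
  -- domination
  have hdom : ∀ w : ℝ, ‖cexp (((-a : ℝ) : ℂ) * (w : ℂ) ^ 2 - b * cexp (4 * (w : ℂ)) + 4 * b * w)‖ ≤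
      ‖gInt (σ : ℂ) (σ : ℂ) w‖ := by
    intro w
    rw [Complex.norm_exp, norm_gInt, Complex.ofReal_re]
    refine Real.exp_le_exp.2 ?_
    have h4 : cexp (4 * (w : ℂ)) = ((Real.exp (4 * w) : ℝ) : ℂ) := by
      rw [Complex.ofReal_exp]; push_cast; ring_nf
    rw [h4]
    simp only [Complex.sub_re, Complex.add_re, Complex.mul_re, Complex.ofReal_re,
      Complex.ofReal_im, Complex.re_ofNat, Complex.im_ofNat, mul_zero, sub_zero, zero_mul,
      ← Complex.ofReal_pow]
    nlinarith [sq_nonneg w, Real.exp_pos (4 * w)]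
  have h1 : ‖rodgersTaoI (-a) b (4 * b)‖ ≤ ∫ w : ℝ, ‖gInt (σ : ℂ) (σ : ℂ) w‖ := by
    rw [rodgersTaoI]
    exact norm_integral_le_of_norm_le hgi.norm (Filter.Eventually.of_forall hdom)
  -- `∫ |gInt σ σ| = Re (G(σ, σ)) = ¼ Γ(σ) σ^{-σ}`
  have h2 : ∫ w : ℝ, ‖gInt (σ : ℂ) (σ : ℂ) w‖ = 1 / 4 * Real.Gamma σ * σ ^ (-σ) := by
    have e1 : (fun w : ℝ ↦ ‖gInt (σ : ℂ) (σ : ℂ) w‖) = fun w : ℝ ↦ (gInt (σ : ℂ) (σ : ℂ) w).re := by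
      funext w
      rw [gInt_ofReal, Complex.norm_real, Complex.ofReal_re, Real.norm_eq_abs, abs_of_pos (Real.exp_pos _)]
    have hre := integral_re hgi
    simp only [RCLike.re_to_complex] at hre
    rw [e1, hre]
    change (Gfun (σ : ℂ) (σ : ℂ)).re = _
    rw [Gfun_ofReal hσ0 (by simpa using hσ0), Complex.Gamma_ofReal,
      show (-(σ : ℂ)) = ((-σ : ℝ) : ℂ) by push_cast; ring, ← Complex.ofReal_cpow hσ0.le]
    norm_cast
    simp
  -- `¼ Γ(σ) σ^{-σ} ≤ e^{-σ}`
  have h3 : 1 / 4 * Real.Gamma σ * σ ^ (-σ) ≤ Real.exp (-σ) := by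
    have hG := real_Gamma_le hb
    have hpow : σ ^ (-σ) = Real.exp (-σ * Real.log σ) := by
      rw [Real.rpow_def_of_pos hσ0]; ring_nf
    rw [hpow]
    calc 1 / 4 * Real.Gamma σ * Real.exp (-σ * Real.log σ)
        ≤ 1 / 4 * (4 * Real.exp ((σ - 1 / 2) * Real.log σ - σ)) * Real.exp (-σ * Real.log σ) := by
          gcongr
      _ = Real.exp ((σ - 1 / 2) * Real.log σ - σ + -σ * Real.log σ) := by rw [Real.exp_add]; ring
      _ ≤ Real.exp (-σ) := Real.exp_le_exp.2 (by nlinarith [Real.log_nonneg hb])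
  exact h1.trans (h2 ▸ h3)

/-- `‖M(b)‖ ≤ e^{−Re b}` for `Re b ≥ 1`. [folklore] -/
private theorem norm_mainTerm_le {b : ℂ} (hb : 1 ≤ b.re) : ‖mainTerm b‖ ≤ Real.exp (-b.re) := by
  have hb0 : b ≠ 0 := by rintro rfl; norm_num at hb
  have hnb1 : 1 ≤ ‖b‖ := hb.trans ((le_abs_self _).trans (Complex.abs_re_le_norm b))
  rw [norm_mainTerm hb0]
  have h1 : Real.sqrt (π / 8) ≤ 1 := by rw [Real.sqrt_le_one]; linarith [Real.pi_lt_four]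
  have h2 : (Real.sqrt ‖b‖)⁻¹ ≤ 1 := by
    apply inv_le_one_of_one_le₀
    rw [show (1:ℝ) = Real.sqrt 1 by simp]; exact Real.sqrt_le_sqrt hnb1
  calc Real.sqrt (π / 8) * Real.exp (-b.re) * (Real.sqrt ‖b‖)⁻¹ ≤ 1 * Real.exp (-b.re) * 1 := by
        gcongr
    _ = Real.exp (-b.re) := by ring

end RodgersTaoStationary

open RodgersTaoStationary in
/-- **Discharge of `Literature.NumberTheory.LFunctions.rodgersTao_I_stationary`** — Rodgers–Tao 2020,
Lemma 2.4 = FMP Lemma 7, eq. (30): for `Re b ≥ 1` and `−T₀ ≤ t < 0`,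
`I_t(b, 4b) = √(π/8) e^{−b} (b^{−1/2} + O_{T₀}(|b|^{−3/2}))`. CONTENT (the printed proof: Gaussian
measure, Fubini, the `Γ`-identity by contour shift, Stirling on `Re s ≥ 1`, tail estimate; the
"small `|b|`" case by the crude bound `‖I_t(b,4b)‖ ≤ e^{−Re b}`).
[cite: RodgersTaoFMP2020, Lemma 2.4 eq. (30) (FMP Lemma 7 p. 15)] -/
theorem rodgersTao_I_stationary_holds : rodgersTao_I_stationary := by
  intro T₀
  set T₁ : ℝ := max T₀ 1 with hT₁
  have hT₁1 : 1 ≤ T₁ := le_max_right _ _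
  have hT₀T₁ : T₀ ≤ T₁ := le_max_left _ _
  set B₀ : ℝ := 4 * T₁ + 4 with hB₀
  have hB₀4 : 4 ≤ B₀ := by rw [hB₀]; linarith
  set A : ℝ := 2 * Real.exp (3 * T₁ + 1) * (1 + T₁) + 10 + 2 * (B₀ * Real.sqrt B₀) with hA
  refine ⟨A, by positivity, ?_⟩
  intro t ht b hb
  obtain ⟨ht₀, ht0⟩ := ht
  set a : ℝ := -t with ha_def
  have ha : 0 < a := by rw [ha_def]; linarith
  have haT : a ≤ T₁ := by rw [ha_def]; linarith
  have hta : t = -a := by rw [ha_def]; ring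
  have hb0 : b ≠ 0 := by rintro rfl; norm_num at hb
  have hnb : 0 < ‖b‖ := norm_pos_iff.2 hb0
  have hnb1 : 1 ≤ ‖b‖ := hb.trans ((le_abs_self _).trans (Complex.abs_re_le_norm b))
  have hsb : 0 < Real.sqrt ‖b‖ := Real.sqrt_pos.2 hnb
  -- rewrite the target
  have hnorm_exp : ‖cexp (-b)‖ = Real.exp (-b.re) := by rw [Complex.norm_exp, Complex.neg_re]
  have hrpow : ‖b‖ ^ (3 / 2 : ℝ) = ‖b‖ * Real.sqrt ‖b‖ := by
    rw [show (3 / 2 : ℝ) = 1 + 1 / 2 by norm_num, Real.rpow_add hnb, Real.rpow_one,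
      Real.sqrt_eq_rpow]
  rw [hta, hnorm_exp, hrpow, show (Real.sqrt (π / 8) : ℂ) * cexp (-b) * b ^ (-(1 / 2 : ℂ)) =
    mainTerm b from rfl]
  have hden : 0 < ‖b‖ * Real.sqrt ‖b‖ := by positivity
  by_cases hbig : B₀ ≤ ‖b‖
  · -- large `‖b‖`
    have h4a : 4 * a ≤ ‖b‖ := by linarith
    have h4 : 4 ≤ ‖b‖ := by linarith
    refine (large_b_bound ha hb h4a h4).trans ?_
    rw [div_le_div_iff_of_pos_right hden]
    refine mul_le_mul_of_nonneg_right ?_ (Real.exp_pos _).le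
    have h1 : Real.exp (3 * a + 1) ≤ Real.exp (3 * T₁ + 1) := Real.exp_le_exp.2 (by linarith)
    have h2 : 2 * Real.exp (3 * a + 1) * (1 + a) ≤ 2 * Real.exp (3 * T₁ + 1) * (1 + T₁) :=
      mul_le_mul (by linarith) (by linarith) (by linarith) (by positivity)
    rw [hA]
    have : 0 ≤ 2 * (B₀ * Real.sqrt B₀) := by positivity
    linarith
  · -- small `‖b‖`
    rw [not_le] at hbig
    have h1 : ‖rodgersTaoI (-a) b (4 * b) - mainTerm b‖ ≤ 2 * Real.exp (-b.re) := by
      refine (norm_sub_le _ _).trans ?_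
      have := norm_rodgersTaoI_le ha.le hb
      have := norm_mainTerm_le hb
      linarith
    refine h1.trans ?_
    rw [le_div_iff₀ hden]
    have h2 : ‖b‖ * Real.sqrt ‖b‖ ≤ B₀ * Real.sqrt B₀ :=
      mul_le_mul hbig.le (Real.sqrt_le_sqrt hbig.le) hsb.le (by linarith)
    have h3 : 2 * (B₀ * Real.sqrt B₀) ≤ A := by
      rw [hA]; have : 0 ≤ 2 * Real.exp (3 * T₁ + 1) * (1 + T₁) := by positivity
      linarith
    have hE := Real.exp_pos (-b.re)
    calc 2 * Real.exp (-b.re) * (‖b‖ * Real.sqrt ‖b‖) ≤ 2 * Real.exp (-b.re) * (B₀ * Real.sqrt B₀) := by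
          gcongr
      _ = 2 * (B₀ * Real.sqrt B₀) * Real.exp (-b.re) := by ring
      _ ≤ A * Real.exp (-b.re) := mul_le_mul_of_nonneg_right h3 hE.le

end Literature.NumberTheory.LFunctions

end
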